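/-
Copyright: lit-balaban cell (HOME `run/shared/lean/pub/lit-balaban/`), Phase-2 proof seat p12 (gen 13).  Statement-level record of
a published text; nothing is claimed beyond what the kernel checks below.
-/
import Literature.MathematicalPhysics.QuantumFieldTheory.FariaDaVeigaOCarroll2022.FdVOC22StabilityBounds
import Literature.MathematicalPhysics.QuantumFieldTheory.TorusFreeTransfer
import HarnessLib

/-!
# `FariaDaVeigaOCarroll2022.FdVOC22PeriodicAndFreeEnergyBounds` — P. A. Faria da Veiga, M. O'Carroll, *On Yang–Mills stability
# bounds and plaquette field generating function*, arXiv:2205.07376 (Rep. Math. Phys. **95** (2025) 303–380)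
# [FariaDaVeigaOCarroll2022YMStability]: **THEOREM 1, periodic b.c.** (sbperiodic) `z_ℓ^{…} ≤ Z^P_{Λ,a} ≤ Z_{Λ,a} ≤ z_u^{Λ_r}`;
# **THEOREM 2** — the single-bond partition functions `z_u`, `z_ℓ` are of exact order `(a^{d−4}/g²)^{−N²/2}` — with SOFT
# constants; and **THEOREM 3 (free b.c.)** — the finite-lattice normalized free energy `f^{n}_{Λ,a} = Λ_r^{−1} ln[(a^{d−4}/
# g²)^{(N²/2)Λ_r} Z_{Λ,a}]` is bounded above and below uniformly in the volume AND in the coupling — PROVED on the tree's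
# carriers, on top of `FdVOC22StabilityBounds` (Theorem 1, free b.c.)

statement-level skeleton of published theorems with citation tags; proofs where landed; nothing here is a claim about
the Yang–Mills mass gap

Source held: `paper:arxiv-2205.07376` (corpus-tex layer; page = chunk `pNNNN`, `L` = line).  Unit `lit-balaban-p12` (gen 13),
free-target protocol G.5-34(d); context row X2 of the cell's `YM-INPRINT.md`.  Companion of `FdVOC22StabilityBounds` (same
namespace; `zu`, `zl`, `Z`, `theorem1_free` are that file's).

WHAT IS PRINTED.  p0014, **Theorem 1** «Periodic b.c.: (sbperiodic) `z_ℓ^{Λ_r+Λ_e} ≤ Z^P_{Λ,a} ≤ Z_{Λ,a} ≤ z_u^{Λ_r}`»,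
with (p0007) «For periodic b.c., the same bond variables are gauged away; the number of non-gauged away bond variables is then
`Λ_r + Λ_e`, where we recall that `Λ_e` is the number of extra bonds we add to `Λ` to implement periodic b.c.».  p0015,
**Theorem 2** «Let `C² = 4N`. Then, we have the bounds» (uzu) «`z_u = 𝒩_C^{−1} ∫_{(−π,π]^N} exp[−2
(a^{d−4}/g²) Σ_j (1 − cos λ_j)] ρ(λ) d^Nλ ≤ (a^{d−4}/g²)^{−N²/2} (π/2)^{N²} 𝒩_G(N) 𝒩_C^{−1}(N) ≡ (a^{d−4}/g²)^{−N²/2} e^{c_u}`»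
and (lzl) «`z_ℓ = … ≥ (a^{d−4}/g²)^{−N²/2} 𝒩_C^{−1}(N) (4/π²)^{N(N−1)/2} [2(d−1)C²]^{−N²/2} I_ℓ ≡ (a^{d−4}/g²)^{−N²/2} e^{c_ℓ}` …
The constants `c_u` and `c_ℓ` are real and finite, independent of `a`, `a ∈ (0,1]` and `g² ∈ (0,g₀²]`, `0 < g₀ < ∞`.»; then
(nZ) «`Z^{B,n}_{Λ,a} = (a^{d−4}/g²)^{(N²/2)Λ_r} Z^B_{Λ,a}`», (nf) «`f^{B,n}_{Λ,a} = Λ_r^{−1} ln Z^{B,n}_{Λ,a}`», «Using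
Theorem 1 and Theorem 2, together with the Bolzano–Weierstrass theorem, we can directly prove» **Theorem 3**: «The normalized
free energy `f^{B,n}_{Λ,a}` converges subsequentially, at least, to a thermodynamic limit `f^{B,n}_a = lim_{Λ ↗ aℤ^d}
f^{B,n}_{Λ,a}`, and, subsequently, again, at least subsequentially, to a continuum limit `f^{B,n} = lim_{a ↘ 0} f^{B,n}_a`.
Besides, `f^{B,n}_a` satisfies the bounds (bdsf) `−∞ < c_ℓ ≤ f^{B,n}_a ≤ c_u < ∞`, and so does `f^{B,n}`. The constants `c_ℓ`
and `c_u` are finite real constants independent of `a ∈ (0,1]` and `g² ∈ (0,g₀²]`, `0 < g₀ < ∞`.»  Proofs: §6.3 (p0018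
L57–63; Weyl integration formula, `1 − cos x ≥ 2x²/π²`, change of variables `y = 2[a^{(d−4)/2}/(πg)]λ`), §6.4 (p0018 L65ff:
«`f^{n}_{Λ,a} = Λ_r^{−1} ln[(a^{d−4}/g²)]^{N²Λ_r/2} + Λ_r^{−1} ln Z_{Λ,a} ≥ … + Λ_r^{−1} ln z_ℓ^{Λ_r} ≥ …`», then the limits by
Bolzano–Weierstrass).

HOW IT IS TYPED.  Periodic b.c.: the cube with `L` sites per side closed up by the `Λ_e = dL^{d−1}` extra bonds is wave 0's
discrete torus `(ℤ/Lℤ)^d` (`Site d L`, `Edge d L`, `Plaquette d L`, `GaugeConfig d L (𝔾 N)`, `plaquetteHolonomy`, `wilsonAction`),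
and `Z^P_{Λ,a}` IS wave 0's `partitionFunction` for the defining representation of `U(N)` (`ZP d N L β` below); it is compared
with the cube through the periodic lift `torusLift L` / `torusEdge L` of `LatticeGaugeDLR` and the marginal lemma
`map_comp_pi_of_injective` of `TorusFreeTransfer`; the «enhanced temporal gauge» of the torus is the cube's comb tree read on the
torus (`torusComb`), fixed with the tree's `AxialGauge.combGauge` (§2b).  Otherwise as in the companion file:
`β = 2a^{d−4}/g²` (so `(a^{d−4}/g²)^{−N²/2} = 2^{N²/2} β^{−N²/2}` and the printed parameter range `a ∈ (0,1]`, `g² ∈ (0,g₀²]`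
is, for `d ≤ 4`, contained in `β ≥ β₀ := 2/g₀² > 0`), gauge group `U(N)`,
`Λ_r = #(AxialGauge.freeEdges d n)`, `z_u = zu N β`, `z_ℓ = zl d N β` (the Frobenius-currency `z_ℓ` of the companion file,
which is `≥` the printed one).  The power `β^{−N²/2}` is carried as `(√β)^{−N·N}` (`Real.sqrt β ^ (N * N)` in denominators).
The finite lattice normalized free energy (nf) is `fn d N n β = Λ_r^{−1} log Z(B_n, β) + (N²/2) log(β/2)` (free b.c.).

SOFT CONSTANTS — what is and is not the print's.  The ORDER `(a^{d−4}/g²)^{−N²/2}` of both bounds and the UNIFORMITY of all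
constants in the volume and in the coupling are proved as printed; the numerical values `e^{c_u} = (π/2)^{N²}𝒩_G𝒩_C^{−1}`,
`e^{c_ℓ} = …I_ℓ` are NOT reproduced (the print gets them from the Weyl integration formula over the maximal torus, which the
tree does not have).  Instead: (uzu) near the identity the Haar probability is dominated by `haarChartConst N ×` Lebesgue measure
in the Cayley chart (the tree's `UnitaryCayley.lintegral_image_chart_le`, Chatterjee's Thm. 11.1) and the weight by the Gaussian
`exp(−(8β/25)‖a‖²)` (inverse-Lipschitz bound of the chart), of integral `(5√(2π)/(4√β))^{N²}`; away from the identity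
(`‖U − 1‖ > 1/5`) the weight is `≤ e^{−β/50} ≤ (N²)! 50^{N²} β^{−N²}`; (lzl) the weight is `≥ e^{−4(d−1)}` on the ball
`‖U − 1‖ ≤ β^{−1/2}`, whose Haar measure is `≥ C₁ β^{−N²/2}` (the tree's `UnitaryCayley.exists_haar_gball_ge`, Chatterjee's
Cor. 6.3), and `z_ℓ` is antitone in `β`.

WHAT IS PROVED (0 sorry, no new `def … : Prop`).  §2: `ZP_eq_lintegral`, the torus Lemma 1
`norm_one_sub_plaquetteHolonomy_sq_le`, the torus incidence count `sum_plaquetteHolonomy_slots_le` and (lower2)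
`wilsonAction_le_sum_edges`, **`zl_pow_card_le_ZP : z_ℓ^{#E(𝕋_L)} ≤ Z^P`** (UNGAUGED form: exponent `dL^d`, weaker than the
printed `Λ_r + Λ_e = dL^d − (L^d − 1)`), **`ZP_le_Z : Z^P_{Λ,a} ≤ Z_{Λ,a}`** and **`ZP_le_zu_pow : Z^P ≤ z_u^{Λ_r}`** as printed,
`theorem1_periodic`; §2b (v1.1): comb-gauge fixing ON THE TORUS — `torusComb` (the cube's comb tree read on `(ℤ/Lℤ)^d`,
`card_torusComb = L^d − 1`, `card_not_isTorusComb = dL^d − (L^d − 1)`, `card_freeEdges_add_closing`: `= Λ_r + Λ_e` with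
`Λ_e = dL^{d−1}`), `torusCombGauge`/`torusGaugeFix` (the tree's
`AxialGauge.combGauge` applied to the cube configuration below the torus one), `torusGaugeFix_of_mem` (gauged bonds carry `1`),
**`map_torusFreePart_pi`** (Lemma 9.3 on the torus: the free part of the gauge-fixed configuration is Haar-distributed, by the
skew-product argument of `AxialGauge.map_freePart_pi`), `lintegral_pi_eq_lintegral_torusExtOne` (Cor. 9.4 on the torus), and
**`zl_pow_le_ZP : z_ℓ^{dL^d − (L^d − 1)} ≤ Z^P`** = the left inequality of (sbperiodic) WITH THE PRINTED EXPONENT `Λ_r + Λ_e`,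
whence **`theorem1_periodic_printed`** = (sbperiodic) as printed.  §1, §3: `zl_anti`; **`exists_zu_le`** (uzu, all `β > 0`);
**`exists_zl_ge`** (lzl, all `β ≥ β₀`, every `β₀ > 0`); the definition `fn` of (nZ)–(nf); **`theorem3_free_bounds`** = (bdsf) at
the finite-lattice level: `∀ β₀ > 0 ∃ c_ℓ c_u ∀ n (Λ_r ≥ 1) ∀ β ≥ β₀, c_ℓ ≤ fn d N n β ≤ c_u`; (v1.1) `fnP` = (nf) for periodic
b.c., `fnP_le_fn`, and **`theorem3_periodic`** (`d ≥ 2`): the SAME `c_ℓ, c_u` bound the torus free energy — `f^P_L ≤ c_u`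
for every `L`, `f^P_L ≥ c_ℓ − ε` for `L ≥ L₀(β, ε)` — i.e. (bdsf) for every thermodynamic limit point of `f^P`, as printed
(§6.4).

NOT HERE (recorded, not claimed): the printed numerical constants of Theorem 2; the (subsequential) limit statements of
Theorem 3, which follow from (bdsf) by Bolzano–Weierstrass and carry no further content (for periodic b.c. the finite-volume
lower bound carries the print's factor `(Λ_e+Λ_r)/Λ_r`, whence the `ε`/`L₀` form of `theorem3_periodic`); the continuum limit
`a ↘ 0` (vacuous at fixed `β`-range: the bounds are uniform); Theorem 4.
-/

noncomputable section

open scoped Matrix.Norms.Frobenius ENNReal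
open MeasureTheory Measure Finset Function
open Literature.Probability.LatticeModels Literature.MathematicalPhysics.QuantumLattice

namespace Literature.MathematicalPhysics.QuantumFieldTheory

namespace FariaDaVeigaOCarroll2022

open UnitaryCayley AxialGauge WilsonWeakCoupling

variable {d N : ℕ}

/-- Matrices `M_N(ℂ)` with the Frobenius (= Hilbert–Schmidt) norm. -/
local notation "𝕄" => Matrix (Fin N) (Fin N) ℂ

/-- Sites of `ℤ^d`. -/
local notation "ZSite" => Literature.Probability.LatticeModels.Site

/-! ## §1. THEOREM 2 with soft constants: the `(a^{d−4}/g²)^{−N²/2}` law of `z_u` and `z_ℓ` -/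

section SingleBond

open GaussianToolkit

/-- `z_ℓ` is antitone in the coupling. [cite: FariaDaVeigaOCarroll2022YMStability, Theorem 1 (zl)] -/
theorem zl_anti {β β' : ℝ} (h : β ≤ β') : zl d N β' ≤ zl d N β :=
  lintegral_mono fun U => by
    refine ENNReal.ofReal_le_ofReal (Real.exp_le_exp.2 ?_)
    have : 0 ≤ 4 * ((d - 1 : ℕ) : ℝ) * ‖(1 : 𝕄) - (U : 𝕄)‖ ^ 2 := by positivity
    nlinarith

/-- The integrand of `z_ℓ` is measurable. [folklore] -/
private theorem measurable_zlWeight' (c : ℝ) :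
    Measurable fun U : 𝔾 N => ENNReal.ofReal (Real.exp (c * ‖(1 : 𝕄) - (U : 𝕄)‖ ^ 2)) := by
  have h : Continuous fun U : 𝔾 N => ‖(1 : 𝕄) - (U : 𝕄)‖ ^ 2 :=
    ((continuous_const.sub continuous_subtype_val).norm).pow 2
  exact ENNReal.measurable_ofReal.comp (Real.measurable_exp.comp (h.measurable.const_mul c))

/-- (lzl) on `β ≥ 1`: the Haar measure of the ball `‖U − 1‖ ≤ β^{−1/2}` is `≥ C₁ β^{−N²/2}` (Chatterjee's Cor. 6.3, in the
tree as `UnitaryCayley.exists_haar_gball_ge`) and the integrand is `≥ e^{−4(d−1)}` there.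
[cite: FariaDaVeigaOCarroll2022YMStability, Theorem 2 (lzl) (chunk p0015)] -/
private theorem zl_ge_aux : ∃ C : ℝ, 0 < C ∧ ∀ β : ℝ, 1 ≤ β →
    ENNReal.ofReal (C / Real.sqrt β ^ (N * N)) ≤ zl d N β := by
  obtain ⟨C₁, hC₁, hball⟩ := exists_haar_gball_ge (N := N)
  refine ⟨Real.exp (-(4 * ((d - 1 : ℕ) : ℝ))) * C₁, by positivity, fun β hβ => ?_⟩
  have hβ0 : 0 < β := by linarith
  have hsq : 0 < Real.sqrt β := Real.sqrt_pos.2 hβ0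
  have hsq1 : 1 ≤ Real.sqrt β := Real.one_le_sqrt.2 hβ
  set δ : ℝ := (Real.sqrt β)⁻¹ with hδ
  have hδ0 : 0 < δ := inv_pos.2 hsq
  have hδ1 : δ ≤ 1 := inv_le_one_of_one_le₀ hsq1
  have hβδ : β * δ ^ 2 = 1 := by
    rw [hδ, inv_pow, Real.sq_sqrt hβ0.le, mul_inv_cancel₀ hβ0.ne']
  have hpt : ∀ U ∈ gball N δ, ENNReal.ofReal (Real.exp (-(4 * ((d - 1 : ℕ) : ℝ)))) ≤
      ENNReal.ofReal (Real.exp (-(4 * ((d - 1 : ℕ) : ℝ) * β) * ‖(1 : 𝕄) - (U : 𝕄)‖ ^ 2)) := by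
    intro U hU
    rw [mem_gball, norm_sub_rev] at hU
    refine ENNReal.ofReal_le_ofReal (Real.exp_le_exp.2 ?_)
    have h2 : ‖(1 : 𝕄) - (U : 𝕄)‖ ^ 2 ≤ δ ^ 2 := pow_le_pow_left₀ (norm_nonneg _) hU 2
    have h4 : 4 * ((d - 1 : ℕ) : ℝ) * β * ‖(1 : 𝕄) - (U : 𝕄)‖ ^ 2 ≤ 4 * ((d - 1 : ℕ) : ℝ) * (β * δ ^ 2) := by
      have := mul_le_mul_of_nonneg_left h2 (by positivity : 0 ≤ 4 * ((d - 1 : ℕ) : ℝ) * β)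
      linarith
    rw [hβδ, mul_one] at h4
    linarith
  calc ENNReal.ofReal (Real.exp (-(4 * ((d - 1 : ℕ) : ℝ))) * C₁ / Real.sqrt β ^ (N * N))
      = ENNReal.ofReal (Real.exp (-(4 * ((d - 1 : ℕ) : ℝ)))) * ENNReal.ofReal (C₁ * δ ^ (N * N)) := by
        rw [← ENNReal.ofReal_mul (Real.exp_pos _).le, hδ, inv_pow, mul_div_assoc, div_eq_mul_inv]
    _ ≤ ENNReal.ofReal (Real.exp (-(4 * ((d - 1 : ℕ) : ℝ)))) * haarProbability (𝔾 N) (gball N δ) := by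
        gcongr; exact hball δ hδ0 hδ1
    _ = ∫⁻ _U in gball N δ, ENNReal.ofReal (Real.exp (-(4 * ((d - 1 : ℕ) : ℝ)))) ∂haarProbability (𝔾 N) := by
        rw [setLIntegral_const]
    _ ≤ ∫⁻ U in gball N δ, ENNReal.ofReal (Real.exp (-(4 * ((d - 1 : ℕ) : ℝ) * β) * ‖(1 : 𝕄) - (U : 𝕄)‖ ^ 2))
          ∂haarProbability (𝔾 N) := setLIntegral_mono (measurable_zlWeight' _) hpt
    _ ≤ zl d N β := setLIntegral_le_lintegral _ _

/-- **THEOREM 2, lower half (lzl), soft constant**: for every `β₀ > 0` there is `C_ℓ > 0` with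
`z_ℓ(β) ≥ C_ℓ (√β)^{−N²}` for ALL `β ≥ β₀` — the print's «`z_ℓ ≥ (a^{d−4}/g²)^{−N²/2} 𝒩_C^{−1}(N) (4/π²)^{N(N−1)/2}
[2(d−1)C²]^{−N²/2} I_ℓ ≡ (a^{d−4}/g²)^{−N²/2} e^{c_ℓ}` … The constants `c_u` and `c_ℓ` are real and finite, independent of `a`,
`a ∈ (0,1]` and `g² ∈ (0,g₀²]`, `0 < g₀ < ∞`» (here `β = 2a^{d−4}/g² ≥ β₀ := 2/g₀²` is exactly that parameter range for
`d ≤ 4`; the constant is not the printed one: the print evaluates it by the Weyl integration formula (§6.3), this file bounds it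
below by the Haar measure of a ball at the identity, and continues to `β < 1` by monotonicity of `z_ℓ` in `β`).
[cite: FariaDaVeigaOCarroll2022YMStability, Theorem 2 (lzl) (chunk p0015); proof §6.3 (p0018)] -/
theorem exists_zl_ge {β₀ : ℝ} (hβ₀ : 0 < β₀) : ∃ C : ℝ, 0 < C ∧ ∀ β : ℝ, β₀ ≤ β →
    ENNReal.ofReal (C / Real.sqrt β ^ (N * N)) ≤ zl d N β := by
  obtain ⟨C, hC, h⟩ := zl_ge_aux (d := d) (N := N)
  refine ⟨C * min 1 (Real.sqrt β₀ ^ (N * N)), by positivity, fun β hβ => ?_⟩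
  have hβpos : 0 < β := hβ₀.trans_le hβ
  have hs0 : 0 < Real.sqrt β ^ (N * N) := pow_pos (Real.sqrt_pos.2 hβpos) _
  rcases le_or_gt 1 β with h1 | h1
  · refine le_trans (ENNReal.ofReal_le_ofReal (div_le_div_of_nonneg_right ?_ hs0.le)) (h β h1)
    calc C * min 1 (Real.sqrt β₀ ^ (N * N)) ≤ C * 1 := by gcongr; exact min_le_left _ _
      _ = C := mul_one C
  · have hzl1 : ENNReal.ofReal C ≤ zl d N 1 := by simpa using h 1 le_rfl
    refine le_trans (ENNReal.ofReal_le_ofReal ?_) (hzl1.trans (zl_anti h1.le))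
    rw [div_le_iff₀ hs0]
    have : min 1 (Real.sqrt β₀ ^ (N * N)) ≤ Real.sqrt β ^ (N * N) :=
      (min_le_right _ _).trans (pow_le_pow_left₀ (Real.sqrt_nonneg _) (Real.sqrt_le_sqrt hβ) _)
    exact mul_le_mul_of_nonneg_left this hC.le

/-- The integrand of `z_u` in norm form is measurable. [folklore] -/
private theorem measurable_zuWeight (β : ℝ) :
    Measurable fun U : 𝔾 N => ENNReal.ofReal (Real.exp (-β * (‖(1 : 𝕄) - (U : 𝕄)‖ ^ 2 / 2))) := by
  have h : Continuous fun U : 𝔾 N => ‖(1 : 𝕄) - (U : 𝕄)‖ ^ 2 / 2 :=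
    (((continuous_const.sub continuous_subtype_val).norm).pow 2).div_const _
  exact ENNReal.measurable_ofReal.comp (Real.measurable_exp.comp (h.measurable.const_mul _))

/-- On the Cayley chart ball `‖a‖ ≤ 1/2`: `(4/5)‖a‖ ≤ ‖1 − chart a‖` (the tree's inverse-Lipschitz bound of the chart).
[folklore] -/
private theorem norm_le_chart {a : 𝔼 N} (ha : ‖a‖ ≤ 1 / 2) : 4 / 5 * ‖a‖ ≤ ‖(1 : 𝕄) - (chart a : 𝕄)‖ := by
  have h := norm_sub_le_norm_chart_sub_chart a 0
  rw [sub_zero, norm_zero, chart_zero, OneMemClass.coe_one, zero_div, add_zero, mul_one] at h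
  rw [norm_sub_rev]
  have h0 : 0 ≤ ‖(chart a : 𝕄) - 1‖ := norm_nonneg _
  nlinarith

/-- (uzu) on `β ≥ 1`: near the identity the Haar measure is dominated by Lebesgue measure in the Cayley chart (Chatterjee's
Thm. 11.1, in the tree as `UnitaryCayley.lintegral_image_chart_le`) and the integrand by the Gaussian `exp(−(8β/25)‖a‖²)`, whose
integral is `(5√(2π)/(4√β))^{N²}`; away from the identity (`‖U − 1‖ > 1/5`) the integrand is `≤ e^{−β/50} ≤ (N²)! 50^{N²}
β^{−N²}`. [cite: FariaDaVeigaOCarroll2022YMStability, Theorem 2 (uzu) (chunk p0015)] -/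
private theorem zu_le_aux : ∃ C : ℝ, 0 < C ∧ ∀ β : ℝ, 1 ≤ β →
    zu N β ≤ ENNReal.ofReal (C / Real.sqrt β ^ (N * N)) := by
  set m : ℕ := N * N with hm
  set K₁ : ℝ := (haarChartConst N : ℝ) * (Real.sqrt (2 * Real.pi) * (5 / 4)) ^ m with hK₁
  set K₂ : ℝ := (m.factorial : ℝ) * 50 ^ m with hK₂
  have hK₁0 : 0 ≤ K₁ := by positivity
  have hK₂0 : 0 ≤ K₂ := by positivity
  refine ⟨K₁ + K₂ + 1, by positivity, fun β hβ => ?_⟩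
  have hβ0 : 0 < β := by linarith
  have hsβ1 : 1 ≤ Real.sqrt β := Real.one_le_sqrt.2 hβ
  have hsβ0 : 0 < Real.sqrt β := by linarith
  have hspow : 0 < Real.sqrt β ^ m := pow_pos hsβ0 m
  set B : Set (𝔼 N) := Metric.closedBall 0 (1 / 2) with hB
  set A : Set (𝔾 N) := chart '' B with hA
  have hAm : MeasurableSet A := measurableSet_image_chart Metric.isClosed_closedBall.measurableSet
  set f : 𝔾 N → ℝ≥0∞ := fun U => ENNReal.ofReal (Real.exp (-β * (‖(1 : 𝕄) - (U : 𝕄)‖ ^ 2 / 2))) with hf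
  -- (i) near the identity: chart comparison and the Gaussian integral
  set c : ℝ := 4 / 5 * Real.sqrt β with hc
  have hc0 : 0 < c := by positivity
  set g : 𝔼 N → ℝ≥0∞ := fun a => ENNReal.ofReal (Real.exp (-‖c • a‖ ^ 2 / 2)) with hg
  have hgm : Measurable g := by
    have : Continuous fun a : 𝔼 N => -‖c • a‖ ^ 2 / 2 := ((continuous_const_smul c).norm.pow 2).neg.div_const _
    exact ENNReal.measurable_ofReal.comp (Real.measurable_exp.comp this.measurable)
  have hptA : ∀ a ∈ B, f (chart a) ≤ g a := by
    intro a ha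
    rw [hB, Metric.mem_closedBall, dist_zero_right] at ha
    simp only [hf, hg]
    refine ENNReal.ofReal_le_ofReal (Real.exp_le_exp.2 ?_)
    have h1 := norm_le_chart (N := N) ha
    have h2 : (4 / 5 * ‖a‖) ^ 2 ≤ ‖(1 : 𝕄) - (chart a : 𝕄)‖ ^ 2 :=
      pow_le_pow_left₀ (by positivity) h1 2
    have h3 : ‖c • a‖ ^ 2 = β * (4 / 5 * ‖a‖) ^ 2 := by
      rw [norm_smul, Real.norm_eq_abs, abs_of_pos hc0, hc]
      nlinarith [Real.sq_sqrt hβ0.le]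
    rw [h3]
    nlinarith [mul_le_mul_of_nonneg_left h2 hβ0.le]
  have hgauss : ∫⁻ a, g a = ENNReal.ofReal ((Real.sqrt (2 * Real.pi) / c) ^ m) := by
    simp only [hg]
    rw [lintegral_comp_smul volume (fun a : 𝔼 N => ENNReal.ofReal (Real.exp (-‖a‖ ^ 2 / 2))) hc0.ne',
      lintegral_exp_neg_norm_sq_div_two, finrank_𝔼, Fintype.card_prod, Fintype.card_fin, ← hm,
      ← ENNReal.ofReal_mul (abs_nonneg _), abs_of_pos (by positivity), div_pow, inv_mul_eq_div]
  have h1 : ∫⁻ U in A, f U ∂haarProbability (𝔾 N) ≤ ENNReal.ofReal (K₁ / Real.sqrt β ^ m) := by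
    calc ∫⁻ U in A, f U ∂haarProbability (𝔾 N)
        ≤ haarChartConst N * ∫⁻ a in B, f (chart a) := lintegral_image_chart_le B f
      _ ≤ haarChartConst N * ∫⁻ a, g a :=
          mul_le_mul_right ((setLIntegral_mono hgm hptA).trans (setLIntegral_le_lintegral _ _)) _
      _ = ENNReal.ofReal (K₁ / Real.sqrt β ^ m) := by
          rw [hgauss, ← ENNReal.ofReal_coe_nnreal, ← ENNReal.ofReal_mul (NNReal.coe_nonneg _), hK₁, hc]
          congr 1
          rw [mul_div_assoc, ← div_pow]
          congr 2
          field_simp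
  -- (ii) away from the identity: `‖U − 1‖ > 1/5`, exponential tail
  have hκ : κ (1 / 2) = 5 / 2 := by norm_num [κ]
  have hsub : gball N (1 / 5) ⊆ A := by
    have h := gball_subset_image_chart (N := N) (r := 1 / 2) (by norm_num) le_rfl
    rw [hκ] at h
    norm_num at h
    exact h
  have htail_pt : ∀ U ∈ Aᶜ, f U ≤ ENNReal.ofReal (Real.exp (-(β / 50))) := by
    intro U hU
    have hU' : ¬ ‖(U : 𝕄) - 1‖ ≤ 1 / 5 := fun h => hU (hsub h)
    simp only [hf]
    refine ENNReal.ofReal_le_ofReal (Real.exp_le_exp.2 ?_)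
    rw [norm_sub_rev] at hU'
    have h5 : 1 / 5 < ‖(1 : 𝕄) - (U : 𝕄)‖ := lt_of_not_ge hU'
    have h25 : 1 / 25 < ‖(1 : 𝕄) - (U : 𝕄)‖ ^ 2 := by nlinarith
    nlinarith
  have hexp : Real.exp (-(β / 50)) ≤ K₂ / Real.sqrt β ^ m := by
    have hfac := Real.pow_div_factorial_le_exp (β / 50) (by positivity) m
    have hmf : (0 : ℝ) < m.factorial := Nat.cast_pos.2 (Nat.factorial_pos m)
    have hβm : 0 < (β / 50) ^ m := pow_pos (by positivity) m
    have h1 : Real.exp (-(β / 50)) ≤ m.factorial / (β / 50) ^ m := by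
      rw [div_le_iff₀ hmf] at hfac
      rw [Real.exp_neg, inv_le_iff_one_le_mul₀ (Real.exp_pos _), div_mul_eq_mul_div, le_div_iff₀ hβm, one_mul]
      linarith
    have h2 : Real.sqrt β ^ m ≤ β ^ m := by
      apply pow_le_pow_left₀ hsβ0.le
      calc Real.sqrt β ≤ Real.sqrt β * Real.sqrt β := le_mul_of_one_le_right hsβ0.le hsβ1
        _ = β := Real.mul_self_sqrt hβ0.le
    calc Real.exp (-(β / 50)) ≤ m.factorial / (β / 50) ^ m := h1
      _ = K₂ / β ^ m := by rw [hK₂, div_pow]; field_simp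
      _ ≤ K₂ / Real.sqrt β ^ m := by gcongr
  have h2 : ∫⁻ U in Aᶜ, f U ∂haarProbability (𝔾 N) ≤ ENNReal.ofReal (K₂ / Real.sqrt β ^ m) := by
    calc ∫⁻ U in Aᶜ, f U ∂haarProbability (𝔾 N)
        ≤ ∫⁻ _U in Aᶜ, ENNReal.ofReal (Real.exp (-(β / 50))) ∂haarProbability (𝔾 N) :=
          setLIntegral_mono measurable_const htail_pt
      _ = ENNReal.ofReal (Real.exp (-(β / 50))) * haarProbability (𝔾 N) Aᶜ := setLIntegral_const _ _
      _ ≤ ENNReal.ofReal (Real.exp (-(β / 50))) * 1 := by gcongr; exact prob_le_one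
      _ ≤ ENNReal.ofReal (K₂ / Real.sqrt β ^ m) := by rw [mul_one]; exact ENNReal.ofReal_le_ofReal hexp
  -- assemble
  rw [zu_eq_lintegral_norm, ← lintegral_add_compl f hAm]
  calc ∫⁻ U in A, f U ∂haarProbability (𝔾 N) + ∫⁻ U in Aᶜ, f U ∂haarProbability (𝔾 N)
      ≤ ENNReal.ofReal (K₁ / Real.sqrt β ^ m) + ENNReal.ofReal (K₂ / Real.sqrt β ^ m) := add_le_add h1 h2
    _ = ENNReal.ofReal ((K₁ + K₂) / Real.sqrt β ^ m) := by
        rw [← ENNReal.ofReal_add (by positivity) (by positivity), add_div]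
    _ ≤ ENNReal.ofReal ((K₁ + K₂ + 1) / Real.sqrt β ^ m) :=
        ENNReal.ofReal_le_ofReal (div_le_div_of_nonneg_right (by linarith) hspow.le)

/-- **THEOREM 2, upper half (uzu), soft constant**: there is `C_u > 0` with `z_u(β) ≤ C_u (√β)^{−N²}` for ALL `β > 0` —
the print's «`z_u ≤ (a^{d−4}/g²)^{−N²/2} (π/2)^{N²} 𝒩_G(N)𝒩_C^{−1}(N) ≡ (a^{d−4}/g²)^{−N²/2} e^{c_u}`» (the constant is not the
printed one: the print evaluates it by the Weyl integration formula (§6.3), this file by the Cayley chart near the identity and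
an exponential tail away from it; for `β < 1` simply `z_u ≤ 1 ≤ C_u (√β)^{−N²}`).
[cite: FariaDaVeigaOCarroll2022YMStability, Theorem 2 (uzu) (chunk p0015); proof §6.3 (p0018)] -/
theorem exists_zu_le : ∃ C : ℝ, 0 < C ∧ ∀ β : ℝ, 0 < β →
    zu N β ≤ ENNReal.ofReal (C / Real.sqrt β ^ (N * N)) := by
  obtain ⟨C, hC, h⟩ := zu_le_aux (N := N)
  refine ⟨C + 1, by positivity, fun β hβ => ?_⟩
  have hs0 : 0 < Real.sqrt β ^ (N * N) := pow_pos (Real.sqrt_pos.2 hβ) _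
  rcases le_or_gt 1 β with h1 | h1
  · exact (h β h1).trans (ENNReal.ofReal_le_ofReal (div_le_div_of_nonneg_right (by linarith) hs0.le))
  · have hs1 : Real.sqrt β ^ (N * N) ≤ 1 := pow_le_one₀ (Real.sqrt_nonneg _) (Real.sqrt_le_one.2 h1.le)
    calc zu N β ≤ 1 := zu_le_one hβ.le
      _ = ENNReal.ofReal 1 := ENNReal.ofReal_one.symm
      _ ≤ ENNReal.ofReal ((C + 1) / Real.sqrt β ^ (N * N)) := by
          refine ENNReal.ofReal_le_ofReal ?_
          rw [le_div_iff₀ hs0, one_mul]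
          linarith

/-! ## §2. THEOREM 1, periodic boundary conditions: `z_ℓ^{|E(𝕋_L)|} ≤ Z^P_{Λ,a} ≤ Z_{Λ,a} ≤ z_u^{Λ_r}` -/

section Periodic

open GaussianToolkit

variable {L : ℕ} [NeZero L]

variable (d N) in
/-- **(part), periodic b.c.**: the Wilson `U(N)` partition function `Z^P_{Λ,a} = ∫ exp[−(a^{d−4}/g²) Σ_p ‖U_p − 1‖²_{H-S}] dg^P`
of the discrete torus `(ℤ/Lℤ)^d` («periodic b.c.», p0006–p0007: the cube with the `Λ_e` extra bonds closing it up
periodically), all bond variables integrated, `β = 2a^{d−4}/g²` — wave 0's `partitionFunction` for the defining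
representation of `U(N)`. [cite: FariaDaVeigaOCarroll2022YMStability, (part) periodic b.c. (chunks p0006–p0007)] -/
abbrev ZP (L : ℕ) [NeZero L] (β : ℝ) : ℝ≥0∞ :=
  partitionFunction (d := d) (L := L) (unitaryFundamentalRep (Fin N) ℂ) β

/-- `Z^P` as an integral over `U(N)^{E(𝕋_L)}`. [cite: FariaDaVeigaOCarroll2022YMStability, (part)] -/
theorem ZP_eq_lintegral (β : ℝ) :
    ZP d N L β = ∫⁻ U, ENNReal.ofReal (Real.exp (-β * wilsonAction (unitaryFundamentalRep (Fin N) ℂ) U))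
      ∂(Measure.pi fun _ : Edge d L => haarProbability (𝔾 N)) := by
  rw [ZP, partitionFunction, wilsonWeight, withDensity_apply _ MeasurableSet.univ, Measure.restrict_univ]

/-- The torus Wilson action in Hilbert–Schmidt form: `S^P(U) = Σ_p ‖1 − U_p‖²/2`.
[cite: FariaDaVeigaOCarroll2022YMStability, (Ap) (chunk p0006)] -/
theorem wilsonAction_eq_sum_norm_sq (U : GaugeConfig d L (𝔾 N)) :
    wilsonAction (unitaryFundamentalRep (Fin N) ℂ) U =
      ∑ p : Plaquette d L, ‖(1 : 𝕄) - ((plaquetteHolonomy U p.1 p.2.1.1 p.2.1.2 : 𝔾 N) : 𝕄)‖ ^ 2 / 2 := by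
  simp only [wilsonAction, unitaryFundamentalRep_apply, sub_re_trace_eq]

/-- `#E(𝕋_L) = d L^d` (all bonds of the torus; the print's `Λ_r + Λ_e + (L^d − 1)`: retained, extra, and gauged-away
bonds). [cite: FariaDaVeigaOCarroll2022YMStability, §2 (chunk p0007)] -/
theorem card_torusEdge : Fintype.card (Edge d L) = d * L ^ d := by
  rw [Fintype.card_prod, Fintype.card_fin, Fintype.card_fun, ZMod.card, Fintype.card_fin, mul_comm]

/-- A lattice point above a torus site. [folklore] -/
private def liftSite (x : Site d L) : ZSite d := fun k => ((x k).val : ℤ)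

/-- `liftSite` is a section of `Torus.proj L`. [folklore] -/
private theorem proj_liftSite (x : Site d L) : Torus.proj L (liftSite x) = x := by
  funext k
  simp only [Torus.proj, liftSite, Int.cast_natCast, ZMod.natCast_zmod_val]

/-- **Lemma 1 on the torus**: `‖1 − U_p‖² ≤ 4 Σ_{j=1}^4 ‖1 − U_j‖²` for every plaquette of `(ℤ/Lℤ)^d` (the cube's Lemma 1
read on the periodic lift). [cite: FariaDaVeigaOCarroll2022YMStability, Lemma 1 (lower1) (chunk p0014)] -/
theorem norm_one_sub_plaquetteHolonomy_sq_le (U : GaugeConfig d L (𝔾 N)) (x : Site d L) (i j : Fin d) :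
    ‖(1 : 𝕄) - ((plaquetteHolonomy U x i j : 𝔾 N) : 𝕄)‖ ^ 2 ≤
      4 * (‖(1 : 𝕄) - (U (x, i) : 𝕄)‖ ^ 2 + ‖(1 : 𝕄) - (U (x.shift i, j) : 𝕄)‖ ^ 2 +
        ‖(1 : 𝕄) - (U (x.shift j, i) : 𝕄)‖ ^ 2 + ‖(1 : 𝕄) - (U (x, j) : 𝕄)‖ ^ 2) := by
  have h := norm_one_sub_plaquette_sq_le (torusLift L U) (liftSite x) i j
  simp only [plaquette_torusLift, torusLift_apply, torusProj_add_single, proj_liftSite, Int.cast_one] at h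
  simpa only [Site.shift] using h

/-- Counting a slot of the plaquettes of the torus fibrewise over the bonds. [folklore] -/
private theorem sum_tslot_eq (E : Plaquette d L → Edge d L) (f : Edge d L → ℝ) :
    ∑ p, f (E p) = ∑ e, (#(univ.filter fun p => E p = e) : ℝ) * f e := by
  rw [← Finset.sum_fiberwise_of_maps_to' (g := E) fun p _ => Finset.mem_univ (E p)]
  refine Finset.sum_congr rfl fun e _ => ?_
  rw [Finset.sum_const, nsmul_eq_mul]

/-- Slot 1 on the torus: plaquettes with first edge `(x, i) = (y, k)` are indexed by `j > k`. [folklore] -/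
private theorem card_tfiber1_le (e : Edge d L) :
    #(univ.filter fun p : Plaquette d L => (p.1, p.2.1.1) = e) ≤ #(Finset.Ioi e.2) := by
  refine Finset.card_le_card_of_injOn (fun p => p.2.1.2) (fun p hp => ?_) (fun p hp p' hp' h => ?_)
  · obtain ⟨-, he⟩ := Finset.mem_filter.1 hp
    rw [Finset.mem_coe, Finset.mem_Ioi, ← he]
    exact p.2.2
  · obtain ⟨-, he⟩ := Finset.mem_filter.1 hp
    obtain ⟨-, he'⟩ := Finset.mem_filter.1 hp'
    obtain ⟨h1, h2⟩ := Prod.mk.inj (he.trans he'.symm)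
    have h3 : p.2.1.2 = p'.2.1.2 := h
    exact Prod.ext h1 (Subtype.ext (Prod.ext h2 h3))

/-- Slot 2 on the torus: plaquettes with second edge `(x + eᵢ, j) = (y, k)` are indexed by `i < k`. [folklore] -/
private theorem card_tfiber2_le (e : Edge d L) :
    #(univ.filter fun p : Plaquette d L => (p.1.shift p.2.1.1, p.2.1.2) = e) ≤ #(Finset.Iio e.2) := by
  refine Finset.card_le_card_of_injOn (fun p => p.2.1.1) (fun p hp => ?_) (fun p hp p' hp' h => ?_)
  · obtain ⟨-, he⟩ := Finset.mem_filter.1 hp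
    rw [Finset.mem_coe, Finset.mem_Iio, ← he]
    exact p.2.2
  · obtain ⟨-, he⟩ := Finset.mem_filter.1 hp
    obtain ⟨-, he'⟩ := Finset.mem_filter.1 hp'
    obtain ⟨h1, h2⟩ := Prod.mk.inj (he.trans he'.symm)
    have h3 : p.2.1.1 = p'.2.1.1 := h
    simp only [Site.shift, h3] at h1
    exact Prod.ext (add_right_cancel h1) (Subtype.ext (Prod.ext h3 h2))

/-- Slot 3 on the torus: plaquettes with third edge `(x + eⱼ, i) = (y, k)` are indexed by `j > k`. [folklore] -/
private theorem card_tfiber3_le (e : Edge d L) :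
    #(univ.filter fun p : Plaquette d L => (p.1.shift p.2.1.2, p.2.1.1) = e) ≤ #(Finset.Ioi e.2) := by
  refine Finset.card_le_card_of_injOn (fun p => p.2.1.2) (fun p hp => ?_) (fun p hp p' hp' h => ?_)
  · obtain ⟨-, he⟩ := Finset.mem_filter.1 hp
    rw [Finset.mem_coe, Finset.mem_Ioi, ← he]
    exact p.2.2
  · obtain ⟨-, he⟩ := Finset.mem_filter.1 hp
    obtain ⟨-, he'⟩ := Finset.mem_filter.1 hp'
    obtain ⟨h1, h2⟩ := Prod.mk.inj (he.trans he'.symm)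
    have h3 : p.2.1.2 = p'.2.1.2 := h
    simp only [Site.shift, h3] at h1
    exact Prod.ext (add_right_cancel h1) (Subtype.ext (Prod.ext h2 h3))

/-- Slot 4 on the torus: plaquettes with fourth edge `(x, j) = (y, k)` are indexed by `i < k`. [folklore] -/
private theorem card_tfiber4_le (e : Edge d L) :
    #(univ.filter fun p : Plaquette d L => (p.1, p.2.1.2) = e) ≤ #(Finset.Iio e.2) := by
  refine Finset.card_le_card_of_injOn (fun p => p.2.1.1) (fun p hp => ?_) (fun p hp p' hp' h => ?_)
  · obtain ⟨-, he⟩ := Finset.mem_filter.1 hp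
    rw [Finset.mem_coe, Finset.mem_Iio, ← he]
    exact p.2.2
  · obtain ⟨-, he⟩ := Finset.mem_filter.1 hp
    obtain ⟨-, he'⟩ := Finset.mem_filter.1 hp'
    obtain ⟨h1, h2⟩ := Prod.mk.inj (he.trans he'.symm)
    have h3 : p.2.1.1 = p'.2.1.1 := h
    exact Prod.ext h1 (Subtype.ext (Prod.ext h3 h2))

/-- **The incidence count on the torus**: every bond of `(ℤ/Lℤ)^d` lies in at most (in fact exactly) `2(d−1)` plaquettes,
so `Σ_p Σ_{e ∈ p} f(e) ≤ 2(d−1) Σ_e f(e)` for `f ≥ 0`.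
[cite: FariaDaVeigaOCarroll2022YMStability, Lemma 1 (lower2) (chunk p0014)] -/
theorem sum_plaquetteHolonomy_slots_le (f : Edge d L → ℝ) (hf : ∀ e, 0 ≤ f e) :
    ∑ p : Plaquette d L, (f (p.1, p.2.1.1) + f (p.1.shift p.2.1.1, p.2.1.2) + f (p.1.shift p.2.1.2, p.2.1.1) +
        f (p.1, p.2.1.2)) ≤ 2 * ((d - 1 : ℕ) : ℝ) * ∑ e : Edge d L, f e := by
  simp only [Finset.sum_add_distrib]
  rw [sum_tslot_eq (fun p => (p.1, p.2.1.1)), sum_tslot_eq (fun p => (p.1.shift p.2.1.1, p.2.1.2)),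
    sum_tslot_eq (fun p => (p.1.shift p.2.1.2, p.2.1.1)), sum_tslot_eq (fun p => (p.1, p.2.1.2)),
    ← Finset.sum_add_distrib, ← Finset.sum_add_distrib, ← Finset.sum_add_distrib, Finset.mul_sum]
  refine Finset.sum_le_sum fun e _ => ?_
  have h1 := card_tfiber1_le e
  have h2 := card_tfiber2_le e
  have h3 := card_tfiber3_le e
  have h4 := card_tfiber4_le e
  rw [Fin.card_Ioi] at h1 h3
  rw [Fin.card_Iio] at h2 h4
  have hk : (e.2 : ℕ) < d := e.2.is_lt
  have hsum : (#(univ.filter fun p : Plaquette d L => (p.1, p.2.1.1) = e) : ℝ) +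
      #(univ.filter fun p : Plaquette d L => (p.1.shift p.2.1.1, p.2.1.2) = e) +
      #(univ.filter fun p : Plaquette d L => (p.1.shift p.2.1.2, p.2.1.1) = e) +
      #(univ.filter fun p : Plaquette d L => (p.1, p.2.1.2) = e) ≤ 2 * ((d - 1 : ℕ) : ℝ) := by
    have : #(univ.filter fun p : Plaquette d L => (p.1, p.2.1.1) = e) +
        #(univ.filter fun p : Plaquette d L => (p.1.shift p.2.1.1, p.2.1.2) = e) +
        #(univ.filter fun p : Plaquette d L => (p.1.shift p.2.1.2, p.2.1.1) = e) +
        #(univ.filter fun p : Plaquette d L => (p.1, p.2.1.2) = e) ≤ 2 * (d - 1) := by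
      omega
    exact_mod_cast this
  have hfe := hf e
  nlinarith

/-- **(lower2) on the torus, no gauge fixed**: `S^P(U) ≤ 4(d−1) Σ_{e ∈ E(𝕋_L)} ‖1 − U_e‖²`.
[cite: FariaDaVeigaOCarroll2022YMStability, Lemma 1 (lower2) (chunk p0014)] -/
theorem wilsonAction_le_sum_edges (U : GaugeConfig d L (𝔾 N)) :
    wilsonAction (unitaryFundamentalRep (Fin N) ℂ) U ≤
      4 * ((d - 1 : ℕ) : ℝ) * ∑ e : Edge d L, ‖(1 : 𝕄) - (U e : 𝕄)‖ ^ 2 := by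
  rw [wilsonAction_eq_sum_norm_sq]
  set f : Edge d L → ℝ := fun e => ‖(1 : 𝕄) - (U e : 𝕄)‖ ^ 2 with hf
  have hf0 : ∀ e, 0 ≤ f e := fun e => by positivity
  have hslots := sum_plaquetteHolonomy_slots_le f hf0
  calc ∑ p : Plaquette d L, ‖(1 : 𝕄) - ((plaquetteHolonomy U p.1 p.2.1.1 p.2.1.2 : 𝔾 N) : 𝕄)‖ ^ 2 / 2
      ≤ ∑ p : Plaquette d L, 2 * (f (p.1, p.2.1.1) + f (p.1.shift p.2.1.1, p.2.1.2) +
          f (p.1.shift p.2.1.2, p.2.1.1) + f (p.1, p.2.1.2)) := by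
        refine Finset.sum_le_sum fun p _ => ?_
        have := norm_one_sub_plaquetteHolonomy_sq_le U p.1 p.2.1.1 p.2.1.2
        simp only [hf]
        linarith
    _ = 2 * ∑ p : Plaquette d L, (f (p.1, p.2.1.1) + f (p.1.shift p.2.1.1, p.2.1.2) +
          f (p.1.shift p.2.1.2, p.2.1.1) + f (p.1, p.2.1.2)) := by rw [← Finset.mul_sum]
    _ ≤ 2 * (2 * ((d - 1 : ℕ) : ℝ) * ∑ e, f e) := by linarith
    _ = 4 * ((d - 1 : ℕ) : ℝ) * ∑ e, f e := by ring

/-- The `z_ℓ` integrand is measurable. [folklore] -/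
private theorem measurable_zlWeightP (c : ℝ) :
    Measurable fun U : 𝔾 N => ENNReal.ofReal (Real.exp (c * ‖(1 : 𝕄) - (U : 𝕄)‖ ^ 2)) := by
  have h : Continuous fun U : 𝔾 N => ‖(1 : 𝕄) - (U : 𝕄)‖ ^ 2 :=
    ((continuous_const.sub continuous_subtype_val).norm).pow 2
  exact ENNReal.measurable_ofReal.comp (Real.measurable_exp.comp (h.measurable.const_mul c))

/-- **Theorem 1, periodic b.c., lower bound — ungauged form**: `z_ℓ^{#E(𝕋_L)} = z_ℓ^{dL^d} ≤ Z^P_{Λ,a}` for `U(N)`, every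
`d`, `L ≥ 1`, `β ≥ 0` (Lemma 1 on every plaquette of the torus, the incidence count `2(d−1)`, Tonelli).  The print's
(sbperiodic) left inequality has the SMALLER exponent `Λ_r + Λ_e = dL^d − (L^d − 1)` (the same comb tree gauged away as
for free b.c., p0007); since `z_ℓ ≤ 1` that printed bound implies this one — the printed exponent is `zl_pow_le_ZP` (§2b,
comb-gauge fixing on the torus); this ungauged form is kept as the elementary first step.
[cite: FariaDaVeigaOCarroll2022YMStability, Theorem 1 (sbperiodic), left inequality — weaker exponent (chunk p0014)] -/
theorem zl_pow_card_le_ZP {β : ℝ} (hβ : 0 ≤ β) : zl d N β ^ Fintype.card (Edge d L) ≤ ZP d N L β := by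
  rw [ZP_eq_lintegral]
  have hmeas : ∀ _e : Edge d L, Measurable fun U : 𝔾 N =>
      ENNReal.ofReal (Real.exp (-(4 * ((d - 1 : ℕ) : ℝ) * β) * ‖(1 : 𝕄) - (U : 𝕄)‖ ^ 2)) :=
    fun _ => measurable_zlWeightP _
  calc zl d N β ^ Fintype.card (Edge d L)
      = ∏ _e : Edge d L, zl d N β := by rw [Finset.prod_const, Finset.card_univ]
    _ = ∫⁻ U, ∏ e : Edge d L, ENNReal.ofReal (Real.exp (-(4 * ((d - 1 : ℕ) : ℝ) * β) * ‖(1 : 𝕄) - (U e : 𝕄)‖ ^ 2))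
          ∂(Measure.pi fun _ : Edge d L => haarProbability (𝔾 N)) := by
        rw [lintegral_fintype_prod_eq_prod _ hmeas]; rfl
    _ ≤ _ := lintegral_mono fun U => ?_
  rw [← ENNReal.ofReal_prod_of_nonneg fun _ _ => (Real.exp_pos _).le, ← Real.exp_sum]
  refine ENNReal.ofReal_le_ofReal (Real.exp_le_exp.2 ?_)
  rw [← Finset.mul_sum]
  have h := wilsonAction_le_sum_edges U
  nlinarith [mul_le_mul_of_nonneg_left h hβ]

omit [NeZero L] in
/-- `Torus.proj L` is injective on the cube `B_L = {0,…,L−1}^d`. [folklore] -/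
private theorem torusProj_injOn_halfOpenBox :
    Set.InjOn (Torus.proj (d := d) L) (halfOpenBox d L : Set (ZSite d)) := by
  intro x hx y hy hxy
  funext k
  have hk : ((x k : ℤ) : ZMod L) = ((y k : ℤ) : ZMod L) := congrFun hxy k
  rw [ZMod.intCast_eq_intCast_iff_dvd_sub] at hk
  obtain ⟨hx1, hx2⟩ := mem_halfOpenBox.1 (Finset.mem_coe.1 hx) k
  obtain ⟨hy1, hy2⟩ := mem_halfOpenBox.1 (Finset.mem_coe.1 hy) k
  have hlt : |y k - x k| < (L : ℤ) := by rw [abs_lt]; constructor <;> linarith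
  have h0 := Int.eq_zero_of_abs_lt_dvd hk hlt
  linarith

/-- The free-b.c. action of the cube `B_L` read on a periodic configuration is at most the torus action: the plaquettes of
`B_L` inject into those of `(ℤ/Lℤ)^d` (the torus has the extra plaquettes through the `Λ_e` closing bonds) and every term
is `≥ 0` — «`Z^P_{Λ,a} ≤ Z_{Λ,a}`» pointwise. [cite: FariaDaVeigaOCarroll2022YMStability, Theorem 1 (sbperiodic), middle
inequality (chunk p0014)] -/
theorem S_torusLift_le_wilsonAction (U : GaugeConfig d L (𝔾 N)) :
    S d N L (torusLift L U) ≤ wilsonAction (unitaryFundamentalRep (Fin N) ℂ) U := by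
  classical
  set c : Site d L × Fin d × Fin d → ℝ := fun t => ‖(1 : 𝕄) - ((plaquetteHolonomy U t.1 t.2.1 t.2.2 : 𝔾 N) : 𝕄)‖ ^ 2 / 2
    with hc
  have hc0 : ∀ t, 0 ≤ c t := fun t => by positivity
  have hL : S d N L (torusLift L U) = ∑ q ∈ plaquettesIn (halfOpenBox d L), c (Torus.proj L q.1, q.2.1, q.2.2) := by
    simp only [WilsonWeakCoupling.S, zdWilsonAction_torusLift, unitaryFundamentalRep_apply, sub_re_trace_eq, hc]
  set emb : Plaquette d L → Site d L × Fin d × Fin d := fun p => (p.1, p.2.1.1, p.2.1.2) with hemb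
  have hemb_inj : Function.Injective emb := by
    intro p p' h
    obtain ⟨h1, h23⟩ := Prod.mk.inj h
    obtain ⟨h2, h3⟩ := Prod.mk.inj h23
    exact Prod.ext h1 (Subtype.ext (Prod.ext h2 h3))
  have hR : wilsonAction (unitaryFundamentalRep (Fin N) ℂ) U = ∑ t ∈ univ.image emb, c t := by
    rw [Finset.sum_image fun p _ p' _ h => hemb_inj h, wilsonAction_eq_sum_norm_sq]
  set σ : Plaq d → Site d L × Fin d × Fin d := fun q => (Torus.proj L q.1, q.2.1, q.2.2) with hσ
  have hσ_inj : Set.InjOn σ (plaquettesIn (halfOpenBox d L) : Set (Plaq d)) := by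
    intro q hq q' hq' h
    obtain ⟨h1, h23⟩ := Prod.mk.inj h
    have hq1 := (Plaq.mem_plaquettesIn.1 (Finset.mem_coe.1 hq)).1
    have hq1' := (Plaq.mem_plaquettesIn.1 (Finset.mem_coe.1 hq')).1
    exact Prod.ext (torusProj_injOn_halfOpenBox (Finset.mem_coe.2 hq1) (Finset.mem_coe.2 hq1') h1) h23
  have hsub : (plaquettesIn (halfOpenBox d L)).image σ ⊆ univ.image emb := by
    intro t ht
    obtain ⟨q, hq, rfl⟩ := Finset.mem_image.1 ht
    have hlt := (Plaq.mem_plaquettesIn.1 hq).2.1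
    exact Finset.mem_image.2 ⟨(Torus.proj L q.1, ⟨(q.2.1, q.2.2), hlt⟩), Finset.mem_univ _, rfl⟩
  rw [hL, hR, ← Finset.sum_image hσ_inj]
  exact Finset.sum_le_sum_of_subset_of_nonneg hsub fun t _ _ => hc0 t

/-- **Theorem 1, periodic b.c., middle inequality**: `Z^P_{Λ,a} ≤ Z_{Λ,a}` — the periodic partition function of the torus
with `L` sites per side is at most the free-b.c. one of the cube with `L` sites per side (drop the plaquettes through the
closing bonds, weights `≤ 1`; the closing bond variables then integrate to `1`), for `U(N)`, every `d`, `L ≥ 1`, `β ≥ 0`.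
[cite: FariaDaVeigaOCarroll2022YMStability, Theorem 1 (sbperiodic), middle inequality (chunk p0014)] -/
theorem ZP_le_Z {β : ℝ} (hβ : 0 ≤ β) : ZP d N L β ≤ Z d N L β := by
  classical
  set τ : ↥(boxEdges d L) → Edge d L := fun e => torusEdge L e.1 with hτ
  have hτinj : Function.Injective τ := by
    intro e e' h
    simp only [hτ, torusEdge, Prod.mk.injEq] at h
    have h1 := (mem_boxEdges.1 e.2).1
    have h1' := (mem_boxEdges.1 e'.2).1
    exact Subtype.ext (Prod.ext (torusProj_injOn_halfOpenBox (Finset.mem_coe.2 h1) (Finset.mem_coe.2 h1') h.1) h.2)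
  have hmeasτ : Measurable fun (U : GaugeConfig d L (𝔾 N)) (e : ↥(boxEdges d L)) => U (τ e) :=
    measurable_pi_lambda _ fun e => measurable_pi_apply _
  have hF : Measurable fun u : BoxCfg d (𝔾 N) L => ENNReal.ofReal (Real.exp (-β * S d N L (ext u))) :=
    ENNReal.measurable_ofReal.comp (Real.measurable_exp.comp ((measurable_S_ext L).const_mul _))
  rw [ZP_eq_lintegral, Z_eq]
  calc ∫⁻ U, ENNReal.ofReal (Real.exp (-β * wilsonAction (unitaryFundamentalRep (Fin N) ℂ) U))
        ∂(Measure.pi fun _ : Edge d L => haarProbability (𝔾 N))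
      ≤ ∫⁻ U, ENNReal.ofReal (Real.exp (-β * S d N L (torusLift L U)))
          ∂(Measure.pi fun _ : Edge d L => haarProbability (𝔾 N)) :=
        lintegral_mono fun U => ENNReal.ofReal_le_ofReal (Real.exp_le_exp.2 (by
          nlinarith [S_torusLift_le_wilsonAction U, hβ]))
    _ = ∫⁻ U, (fun u : BoxCfg d (𝔾 N) L => ENNReal.ofReal (Real.exp (-β * S d N L (ext u)))) (fun e => U (τ e))
          ∂(Measure.pi fun _ : Edge d L => haarProbability (𝔾 N)) := by
        refine lintegral_congr fun U => ?_
        have h : (fun e : ↥(boxEdges d L) => U (τ e)) = (boxEdges d L).restrict (torusLift L U) := rfl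
        simp only [h, WilsonWeakCoupling.S, zdWilsonAction_ext_restrict]
    _ = ∫⁻ u, ENNReal.ofReal (Real.exp (-β * S d N L (ext u)))
          ∂((Measure.pi fun _ : Edge d L => haarProbability (𝔾 N)).map fun U e => U (τ e)) :=
        (lintegral_map hF hmeasτ).symm
    _ = _ := by rw [map_comp_pi_of_injective _ hτinj]

/-- **Theorem 1, periodic b.c., upper bound**: `Z^P_{Λ,a} ≤ Z_{Λ,a} ≤ z_u^{Λ_r}`.
[cite: FariaDaVeigaOCarroll2022YMStability, Theorem 1 (sbperiodic), right inequalities (chunk p0014)] -/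
theorem ZP_le_zu_pow {β : ℝ} (hβ : 0 ≤ β) : ZP d N L β ≤ zu N β ^ #(freeEdges d L) :=
  (ZP_le_Z hβ).trans (Z_le_zu_pow hβ L)

/-- **THEOREM 1, periodic boundary conditions**, ungauged form: `z_ℓ^{dL^d} ≤ Z^P_{Λ,a} ≤ Z_{Λ,a} ≤ z_u^{Λ_r}` for `U(N)`,
every `d`, every torus side `L ≥ 1` and every `β ≥ 0` — the print's (sbperiodic) «`z_ℓ^{Λ_r+Λ_e} ≤ Z^P_{Λ,a} ≤ Z_{Λ,a} ≤
z_u^{Λ_r}`» with the middle and right inequalities as printed and the left one with the larger exponent `#E(𝕋_L) = dL^d ≥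
Λ_r + Λ_e` (see `theorem1_periodic_printed`, §2b, for the printed exponent).
[cite: FariaDaVeigaOCarroll2022YMStability, Theorem 1 (sbperiodic) (chunk p0014); proof §6.2 (p0018)] -/
theorem theorem1_periodic {β : ℝ} (hβ : 0 ≤ β) :
    zl d N β ^ (d * L ^ d) ≤ ZP d N L β ∧ ZP d N L β ≤ Z d N L β ∧ Z d N L β ≤ zu N β ^ #(freeEdges d L) := by
  refine ⟨?_, ZP_le_Z hβ, Z_le_zu_pow hβ L⟩
  rw [← card_torusEdge]
  exact zl_pow_card_le_ZP hβ

end Periodic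

/-! ## §2b. The printed exponent `Λ_r + Λ_e`: comb-gauge fixing on the torus -/

section PeriodicGauge

open GaussianToolkit

variable {L : ℕ} [NeZero L]

variable (d L) in
/-- **The gauged-away bonds of the torus**: the cube's comb tree `E_L^0` («the same bond variables are gauged away», p0007)
read on `(ℤ/Lℤ)^d` — the torus edges `(x mod L, i)` with `(x, i) ∈ E_L^0` (`x ∈ B_L`, `x + eᵢ ∈ B_L`, `x_k = 0` for `k > i`).
[cite: FariaDaVeigaOCarroll2022YMStability, §2 «For periodic b.c., the same bond variables are gauged away» (chunk p0007)] -/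
def torusComb : Finset (Edge d L) := (combEdges d L).image (torusEdge L)

omit [NeZero L] in
/-- `torusEdge L` is injective on the edges of the cube `B_L`. [folklore] -/
private theorem torusEdge_injOn_boxEdges : Set.InjOn (torusEdge (d := d) L) (boxEdges d L : Set (ZdEdge d)) := by
  intro e he e' he' h
  simp only [torusEdge, Prod.mk.injEq] at h
  have h1 := (mem_boxEdges.1 (Finset.mem_coe.1 he)).1
  have h1' := (mem_boxEdges.1 (Finset.mem_coe.1 he')).1
  exact Prod.ext (torusProj_injOn_halfOpenBox (Finset.mem_coe.2 h1) (Finset.mem_coe.2 h1') h.1) h.2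

omit [NeZero L] in
/-- Comb edges are edges of the cube. [folklore] -/
private theorem mem_boxEdges_of_mem_combEdges {e : ZdEdge d} (he : e ∈ combEdges d L) : e ∈ boxEdges d L :=
  (Finset.mem_filter.1 he).1

omit [NeZero L] in
/-- `#E^0 = L^d − 1` on the torus too (a spanning tree of the `L^d` sites).
[cite: FariaDaVeigaOCarroll2022YMStability, §2 (chunk p0007)] -/
theorem card_torusComb : #(torusComb d L) = L ^ d - 1 := by
  rw [torusComb, Finset.card_image_of_injOn fun e he e' he' h =>
    torusEdge_injOn_boxEdges (Finset.mem_coe.2 (mem_boxEdges_of_mem_combEdges he))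
      (Finset.mem_coe.2 (mem_boxEdges_of_mem_combEdges he')) h, card_combEdges]

/-- Being a gauged-away bond, as a predicate (kept a `def` so that the sub-products below are indexed by plain subtypes).
[cite: FariaDaVeigaOCarroll2022YMStability, §2 (chunk p0007)] -/
def IsTorusComb (e : Edge d L) : Prop := e ∈ torusComb d L

/-- Being a gauged-away bond is decidable. [folklore] -/
instance instDecidablePredIsTorusComb : DecidablePred (IsTorusComb (d := d) (L := L)) :=
  fun e => inferInstanceAs (Decidable (e ∈ torusComb d L))

/-- **`Λ_r + Λ_e`**: the number of bonds of the torus that are NOT gauged away is `dL^d − (L^d − 1)` (`= Λ_r + Λ_e` with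
`Λ_r = (d−1)L^d − dL^{d−1} + 1` retained cube bonds and `Λ_e = dL^{d−1}` closing bonds).
[cite: FariaDaVeigaOCarroll2022YMStability, §2 «the number of non-gauged away bond variables is then Λ_r + Λ_e» (chunk p0007)] -/
theorem card_not_isTorusComb : Fintype.card {e : Edge d L // ¬ IsTorusComb e} = d * L ^ d - (L ^ d - 1) := by
  classical
  have h : Fintype.card {e : Edge d L // IsTorusComb e} = #(torusComb d L) := by
    rw [Fintype.card_subtype]
    congr 1
    ext e
    simp [IsTorusComb]
  rw [Fintype.card_subtype_compl, h, card_torusComb, card_torusEdge]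

omit [NeZero L] in
/-- **The printed split of the exponent**: `Λ_r + Λ_e = dL^d − (L^d − 1)` with `Λ_r = #E_L^1` the retained cube bonds and
`Λ_e = dL^{d−1}` the closing bonds of the torus (`L, d ≥ 1`). [cite: FariaDaVeigaOCarroll2022YMStability, §2 «the number of
non-gauged away bond variables is then Λ_r + Λ_e» (chunk p0007)] -/
theorem card_freeEdges_add_closing (hd : 1 ≤ d) (hL : 1 ≤ L) :
    #(freeEdges d L) + d * L ^ (d - 1) = d * L ^ d - (L ^ d - 1) := by
  have h1 := card_boxEdges_eq_add (d := d) L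
  rw [card_boxEdges, card_combEdges] at h1
  have hpow : L ^ d = L * L ^ (d - 1) := by
    rw [← pow_succ']; congr 1; omega
  have hLd : 1 ≤ L ^ d := Nat.one_le_pow _ _ hL
  have hle : L ^ d - 1 ≤ d * L ^ d := le_trans (Nat.sub_le _ _) (Nat.le_mul_of_pos_left _ hd)
  zify [hL, hLd, hle] at h1 hpow ⊢
  linear_combination (-1 : ℤ) * h1 - (d : ℤ) * hpow

/-- The lattice point above a torus site projects back onto sites of the cube. [folklore] -/
private theorem liftSite_proj {x : ZSite d} (hx : x ∈ halfOpenBox d L) : liftSite (Torus.proj L x) = x := by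
  funext k
  obtain ⟨h0, hL⟩ := mem_halfOpenBox.1 hx k
  simp only [liftSite, Torus.proj, ZMod.val_intCast]
  exact Int.emod_eq_of_lt h0 hL

/-- The cube configuration read off a torus configuration (`1` off the cube): `W_U = ext(U ∘ torusEdge |_{E_L})`. [folklore] -/
private def cubeCfg (U : GaugeConfig d L (𝔾 N)) : ZdGaugeConfig d (𝔾 N) :=
  ext ((boxEdges d L).restrict (torusLift L U))

omit [NeZero L] in
/-- `W_U` on a cube edge is the torus variable below it. [folklore] -/
private theorem cubeCfg_apply_of_mem (U : GaugeConfig d L (𝔾 N)) {e : ZdEdge d} (he : e ∈ boxEdges d L) :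
    cubeCfg U e = U (torusEdge L e) := by
  rw [cubeCfg, ext_apply_of_mem _ he]; rfl

omit [NeZero L] in
/-- `W_U` is measurable in `U`. [folklore] -/
private theorem measurable_cubeCfg : Measurable (cubeCfg (d := d) (N := N) (L := L)) :=
  measurable_ext.comp ((Finset.measurable_restrict _).comp (measurable_pi_lambda _ fun _ => measurable_pi_apply _))

/-- **The comb gauge of the torus**: `h_U(x) = G_{W_U}(x̃)`, the cube's comb holonomy (Chatterjee's `G_U`, the tree's
`AxialGauge.combGauge`) from `0` to the representative `x̃ ∈ B_L` of `x`.
[cite: FariaDaVeigaOCarroll2022YMStability, §2 (chunk p0007)] -/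
def torusCombGauge (U : GaugeConfig d L (𝔾 N)) (x : Site d L) : 𝔾 N := combGauge (cubeCfg U) (liftSite x)

/-- **The gauge-fixed torus configuration** `V_U = h_U · U` («enhanced temporal gauge», periodic b.c.).
[cite: FariaDaVeigaOCarroll2022YMStability, §2 (chunk p0007)] -/
def torusGaugeFix (U : GaugeConfig d L (𝔾 N)) : GaugeConfig d L (𝔾 N) := gaugeTransform (torusCombGauge U) U

/-- **The gauged-away bonds carry `1`**: `V_U = 1` on the torus comb tree (Chatterjee's Prop. 9.2 read on the torus).
[cite: FariaDaVeigaOCarroll2022YMStability, §2 «gauged away … setting … bond variables to 1» (chunk p0007)] -/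
theorem torusGaugeFix_of_mem {U : GaugeConfig d L (𝔾 N)} {e : Edge d L} (he : e ∈ torusComb d L) :
    torusGaugeFix U e = 1 := by
  obtain ⟨⟨x, i⟩, hc, rfl⟩ := Finset.mem_image.1 he
  have hbox : (x, i) ∈ boxEdges d L := mem_boxEdges_of_mem_combEdges hc
  have hcomb : IsComb (x, i) := (Finset.mem_filter.1 hc).2
  obtain ⟨hx, hxi⟩ := mem_boxEdges.1 hbox
  have hx0 : 0 ≤ x i := (mem_halfOpenBox.1 hx i).1
  have h1 : liftSite (Torus.proj L x) = x := liftSite_proj hx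
  have h2 : liftSite (Site.shift (Torus.proj L x) i) = x + Pi.single i 1 := by
    have hs : Torus.proj L (x + Pi.single i 1) = Torus.proj L x + Pi.single i 1 := by
      rw [torusProj_add_single, Int.cast_one]
    rw [Site.shift, ← hs, liftSite_proj hxi]
  have h3 := gaugeFix_of_isComb (U := cubeCfg U) hcomb hx0
  rw [gaugeFix_apply, cubeCfg_apply_of_mem U hbox] at h3
  simp only [torusGaugeFix, gaugeTransform, torusCombGauge, torusEdge, h1, h2]
  exact h3

/-- The torus action is invariant under the comb gauge fixing. [cite: FariaDaVeigaOCarroll2022YMStability, §2 «the value of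
the partition function is unchanged» (chunk p0007)] -/
theorem wilsonAction_torusGaugeFix (U : GaugeConfig d L (𝔾 N)) :
    wilsonAction (unitaryFundamentalRep (Fin N) ℂ) (torusGaugeFix U) = wilsonAction (unitaryFundamentalRep (Fin N) ℂ) U :=
  wilsonAction_gaugeTransform _ _ U

/-- The configuration equal to `w` off the comb tree and to `1` on it. [folklore] -/
def torusExtOne (w : {e : Edge d L // ¬ IsTorusComb e} → 𝔾 N) : GaugeConfig d L (𝔾 N) :=
  fun e => if h : IsTorusComb e then 1 else w ⟨e, h⟩

/-- The free (non-comb) part of the gauge-fixed configuration. [folklore] -/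
def torusFreePart (U : GaugeConfig d L (𝔾 N)) : {e : Edge d L // ¬ IsTorusComb e} → 𝔾 N :=
  fun e => torusGaugeFix U e.1

/-- `V_U` is `1` on the tree and its free part elsewhere. [folklore] -/
private theorem torusGaugeFix_eq_torusExtOne (U : GaugeConfig d L (𝔾 N)) : torusGaugeFix U = torusExtOne (torusFreePart U) := by
  funext e
  by_cases h : IsTorusComb e
  · rw [torusGaugeFix_of_mem h, torusExtOne, dif_pos h]
  · rw [torusExtOne, dif_neg h]; rfl

omit [NeZero L] in
/-- `torusExtOne` is measurable. [folklore] -/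
private theorem measurable_torusExtOne : Measurable (torusExtOne (d := d) (N := N) (L := L)) := by
  refine measurable_pi_lambda _ fun e => ?_
  by_cases h : IsTorusComb e
  · simp only [torusExtOne, dif_pos h]; exact measurable_const
  · simp only [torusExtOne, dif_neg h]; exact measurable_pi_apply _

omit [NeZero L] in
/-- The comb gauge is measurable in the configuration. [folklore] -/
private theorem measurable_torusCombGauge (x : Site d L) :
    Measurable fun U : GaugeConfig d L (𝔾 N) => torusCombGauge U x :=
  (measurable_combGauge _).comp measurable_cubeCfg

omit [NeZero L] in
/-- The free part is measurable. [folklore] -/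
private theorem measurable_torusFreePart : Measurable (torusFreePart (d := d) (N := N) (L := L)) := by
  refine measurable_pi_lambda _ fun e => ?_
  simp only [torusFreePart, torusGaugeFix, gaugeTransform]
  exact ((measurable_torusCombGauge _).mul (measurable_pi_apply _)).mul (measurable_torusCombGauge _).inv

/-- **Lemma 9.3 on the torus (gauge fixing preserves the product structure)**: under the product Haar measure on
`U(N)^{E(𝕋_L)}`, the free part of the comb-gauge-fixed configuration is distributed according to the product Haar measure on
`U(N)^{E(𝕋_L) ∖ E^0}` — conditionally on the tree variables each `V(x,i) = h(x) U(x,i) h(x+eᵢ)⁻¹` off the tree is a two-sided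
translate of an independent Haar variable (Chatterjee's Lemma 9.3; here «(see [GJ])», p0007).
[cite: FariaDaVeigaOCarroll2022YMStability, §2 «the value of the partition function is unchanged … (see [GJ])» (chunk p0007)] -/
theorem map_torusFreePart_pi :
    (Measure.pi fun _ : Edge d L => haarProbability (𝔾 N)).map torusFreePart =
      Measure.pi fun _ : {e : Edge d L // ¬ IsTorusComb e} => haarProbability (𝔾 N) := by
  set p : Edge d L → Prop := IsTorusComb (d := d) (L := L) with hp
  set π := Measure.pi fun _ : Edge d L => haarProbability (𝔾 N) with hπ
  set π₀ := Measure.pi fun _ : {e : Edge d L // p e} => haarProbability (𝔾 N) with hπ₀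
  set π₁ := Measure.pi fun _ : {e : Edge d L // ¬ p e} => haarProbability (𝔾 N) with hπ₁
  set e₀ := MeasurableEquiv.piEquivPiSubtypeProd (fun _ : Edge d L => 𝔾 N) p with he₀
  have hmp : MeasurePreserving e₀ π (π₀.prod π₁) := measurePreserving_piEquivPiSubtypeProd _ p
  -- the comb gauge as a function of the tree part only
  set A : ({e : Edge d L // p e} → 𝔾 N) → Site d L → 𝔾 N :=
    fun t x => torusCombGauge (e₀.symm (t, fun _ => 1)) x with hA
  have hAu : ∀ (U : GaugeConfig d L (𝔾 N)) (x : Site d L), torusCombGauge U x = A (e₀ U).1 x := by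
    intro U x
    refine combGauge_congr (fun c hc => ?_) (liftSite x)
    by_cases hmem : c ∈ boxEdges d L
    · rw [cubeCfg_apply_of_mem _ hmem, cubeCfg_apply_of_mem _ hmem]
      have hpc : p (torusEdge L c) := Finset.mem_image.2 ⟨c, Finset.mem_filter.2 ⟨hmem, hc⟩, rfl⟩
      simp [he₀, MeasurableEquiv.piEquivPiSubtypeProd, Equiv.piEquivPiSubtypeProd, hpc]
    · simp only [cubeCfg, ext_apply_of_not_mem _ hmem]
  have hAm : ∀ x : Site d L, Measurable fun t => A t x := fun x =>
    (measurable_torusCombGauge x).comp (e₀.symm.measurable.comp (measurable_id.prodMk measurable_const))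
  -- the conditional two-sided translation
  set K : ({e : Edge d L // p e} → 𝔾 N) → ({e : Edge d L // ¬ p e} → 𝔾 N) → ({e : Edge d L // ¬ p e} → 𝔾 N) :=
    fun t w e => A t e.1.1 * w e * (A t (e.1.1.shift e.1.2))⁻¹ with hK
  have hKfree : ∀ t w, torusFreePart (e₀.symm (t, w)) = K t w := by
    intro t w
    funext e
    change torusGaugeFix (e₀.symm (t, w)) e.1 = _
    simp only [torusGaugeFix, gaugeTransform, hAu, e₀.apply_symm_apply, hK]
    congr 2
    have hne : ¬ p e.1 := e.2
    simp [he₀, MeasurableEquiv.piEquivPiSubtypeProd, Equiv.piEquivPiSubtypeProd, hne]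
  have hKpres : ∀ t, MeasurePreserving (K t) π₁ π₁ := fun t =>
    measurePreserving_pi _ _ fun e =>
      (measurePreserving_mul_right (haarProbability (𝔾 N)) _).comp
        (measurePreserving_mul_left (haarProbability (𝔾 N)) _)
  have hKmeas : Measurable (Function.uncurry K) := by
    refine measurable_pi_lambda _ fun e => ?_
    exact (((hAm _).comp measurable_fst).mul ((measurable_pi_apply e).comp measurable_snd)).mul
      ((hAm _).comp measurable_fst).inv
  have hskew : MeasurePreserving (fun q : _ × _ => (q.1, K q.1 q.2)) (π₀.prod π₁) (π₀.prod π₁) :=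
    (MeasurePreserving.id π₀).skew_product hKmeas (Filter.Eventually.of_forall fun t => (hKpres t).map_eq)
  have hcomp : torusFreePart ∘ e₀.symm = Prod.snd ∘ fun q : _ × _ => (q.1, K q.1 q.2) := by
    funext ⟨t, w⟩; exact hKfree t w
  calc π.map torusFreePart = ((π₀.prod π₁).map e₀.symm).map torusFreePart := by rw [hmp.symm.map_eq]
    _ = (π₀.prod π₁).map (torusFreePart ∘ e₀.symm) := Measure.map_map measurable_torusFreePart e₀.symm.measurable
    _ = ((π₀.prod π₁).map fun q : _ × _ => (q.1, K q.1 q.2)).map Prod.snd := by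
        rw [hcomp, Measure.map_map measurable_snd hskew.measurable]
    _ = (π₀.prod π₁).map Prod.snd := by rw [hskew.map_eq]
    _ = π₁ := by rw [Measure.map_snd_prod, measure_univ, one_smul]

/-- **Integration in the comb gauge on the torus** (Chatterjee's Cor. 9.4 read on the torus; the print's «gauging away … the value
of the partition function is unchanged (see [GJ])»): for a measurable `Φ ≥ 0` invariant under the comb gauge fixing,
`∫ Φ dσ^{E(𝕋_L)} = ∫ Φ(1 on E^0, w off E^0) dσ^{E(𝕋_L) ∖ E^0}(w)`.
[cite: FariaDaVeigaOCarroll2022YMStability, §2 (chunk p0007)] -/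
theorem lintegral_pi_eq_lintegral_torusExtOne {Φ : GaugeConfig d L (𝔾 N) → ℝ≥0∞} (hΦ : Measurable Φ)
    (hinv : ∀ U, Φ (torusGaugeFix U) = Φ U) :
    ∫⁻ U, Φ U ∂(Measure.pi fun _ : Edge d L => haarProbability (𝔾 N)) =
      ∫⁻ w, Φ (torusExtOne w) ∂(Measure.pi fun _ : {e : Edge d L // ¬ IsTorusComb e} => haarProbability (𝔾 N)) := by
  calc ∫⁻ U, Φ U ∂(Measure.pi fun _ : Edge d L => haarProbability (𝔾 N))
      = ∫⁻ U, (Φ ∘ torusExtOne) (torusFreePart U) ∂(Measure.pi fun _ : Edge d L => haarProbability (𝔾 N)) :=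
        lintegral_congr fun U => by rw [Function.comp_apply, ← torusGaugeFix_eq_torusExtOne, hinv]
    _ = ∫⁻ w, (Φ ∘ torusExtOne) w ∂((Measure.pi fun _ : Edge d L => haarProbability (𝔾 N)).map torusFreePart) :=
        (lintegral_map (hΦ.comp measurable_torusExtOne) measurable_torusFreePart).symm
    _ = _ := by rw [map_torusFreePart_pi]; rfl

/-- The torus weight is measurable. [folklore] -/
private theorem measurable_torusWeight (β : ℝ) :
    Measurable fun U : GaugeConfig d L (𝔾 N) =>
      ENNReal.ofReal (Real.exp (-β * wilsonAction (unitaryFundamentalRep (Fin N) ℂ) U)) :=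
  ENNReal.measurable_ofReal.comp (Real.measurable_exp.comp
    ((continuous_wilsonAction _ (continuous_unitaryFundamentalRep (Fin N) ℂ)).measurable.const_mul _))

/-- **Theorem 1, periodic b.c., lower bound AS PRINTED**: `z_ℓ^{Λ_r+Λ_e} ≤ Z^P_{Λ,a}` with `Λ_r + Λ_e = dL^d − (L^d − 1)` the
number of bonds NOT gauged away («the same bond variables are gauged away», the cube's comb tree read on the torus), for
`U(N)`, every `d`, every torus side `L ≥ 1`, every `β ≥ 0`: comb-gauge fixing on the torus
(`lintegral_pi_eq_lintegral_torusExtOne`), Lemma 1 on every plaquette, the incidence count `2(d−1)` (the gauged bonds contribute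
`‖1 − 1‖² = 0`), Tonelli.
[cite: FariaDaVeigaOCarroll2022YMStability, Theorem 1 (sbperiodic), left inequality (chunk p0014); proof §6.2 (p0018)] -/
theorem zl_pow_le_ZP {β : ℝ} (hβ : 0 ≤ β) : zl d N β ^ (d * L ^ d - (L ^ d - 1)) ≤ ZP d N L β := by
  classical
  rw [← card_not_isTorusComb, ZP_eq_lintegral,
    lintegral_pi_eq_lintegral_torusExtOne (measurable_torusWeight β) fun U => by rw [wilsonAction_torusGaugeFix]]
  have hmeas : ∀ _e : {e : Edge d L // ¬ IsTorusComb e}, Measurable fun U : 𝔾 N =>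
      ENNReal.ofReal (Real.exp (-(4 * ((d - 1 : ℕ) : ℝ) * β) * ‖(1 : 𝕄) - (U : 𝕄)‖ ^ 2)) :=
    fun _ => measurable_zlWeightP _
  calc zl d N β ^ Fintype.card {e : Edge d L // ¬ IsTorusComb e}
      = ∏ _e : {e : Edge d L // ¬ IsTorusComb e}, zl d N β := by rw [Finset.prod_const, Finset.card_univ]
    _ = ∫⁻ w, ∏ e : {e : Edge d L // ¬ IsTorusComb e},
          ENNReal.ofReal (Real.exp (-(4 * ((d - 1 : ℕ) : ℝ) * β) * ‖(1 : 𝕄) - (w e : 𝕄)‖ ^ 2))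
          ∂(Measure.pi fun _ => haarProbability (𝔾 N)) := by
        rw [lintegral_fintype_prod_eq_prod _ hmeas]; rfl
    _ ≤ _ := lintegral_mono fun w => ?_
  rw [← ENNReal.ofReal_prod_of_nonneg fun _ _ => (Real.exp_pos _).le, ← Real.exp_sum]
  refine ENNReal.ofReal_le_ofReal (Real.exp_le_exp.2 ?_)
  rw [← Finset.mul_sum]
  have h := wilsonAction_le_sum_edges (torusExtOne w)
  -- the gauged bonds contribute nothing to `Σ_e ‖1 − V_e‖²`
  have hsplit : ∑ e : Edge d L, ‖(1 : 𝕄) - (torusExtOne w e : 𝕄)‖ ^ 2 =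
      ∑ e : {e : Edge d L // ¬ IsTorusComb e}, ‖(1 : 𝕄) - (w e : 𝕄)‖ ^ 2 := by
    have hs := Fintype.sum_subtype_add_sum_subtype (IsTorusComb (d := d) (L := L))
      (fun e : Edge d L => ‖(1 : 𝕄) - (torusExtOne w e : 𝕄)‖ ^ 2)
    have h0 : ∑ e : {e : Edge d L // IsTorusComb e}, ‖(1 : 𝕄) - (torusExtOne w e : 𝕄)‖ ^ 2 = 0 :=
      Finset.sum_eq_zero fun e _ => by rw [torusExtOne, dif_pos e.2]; simp
    rw [← hs, h0, zero_add]
    refine Finset.sum_congr rfl fun e _ => ?_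
    rw [torusExtOne, dif_neg e.2]
  rw [hsplit] at h
  nlinarith [mul_le_mul_of_nonneg_left h hβ]

/-- **THEOREM 1, periodic boundary conditions, AS PRINTED**: «`z_ℓ^{Λ_r+Λ_e} ≤ Z^P_{Λ,a} ≤ Z_{Λ,a} ≤ z_u^{Λ_r}`» for `U(N)`,
every `d`, every torus side `L ≥ 1` and every `β ≥ 0`, with `Λ_r + Λ_e = dL^d − (L^d − 1)` and `Λ_r = #E_L^1`.
[cite: FariaDaVeigaOCarroll2022YMStability, Theorem 1 (sbperiodic) (chunk p0014); proof §6.2 (p0018)] -/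
theorem theorem1_periodic_printed {β : ℝ} (hβ : 0 ≤ β) :
    zl d N β ^ (d * L ^ d - (L ^ d - 1)) ≤ ZP d N L β ∧ ZP d N L β ≤ Z d N L β ∧
      Z d N L β ≤ zu N β ^ #(freeEdges d L) :=
  ⟨zl_pow_le_ZP hβ, ZP_le_Z hβ, Z_le_zu_pow hβ L⟩

end PeriodicGauge

/-! ## §3. THEOREM 3 (free b.c.): the normalized free energy is bounded, uniformly in the volume and in the coupling -/

variable (d N) in
/-- The finite-lattice **normalized free energy** (nZ)–(nf) «`Z^{B,n}_{Λ,a} = (a^{d−4}/g²)^{(N²/2)Λ_r} Z^B_{Λ,a}`,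
`f^{B,n}_{Λ,a} = Λ_r^{−1} ln Z^{B,n}_{Λ,a}`», free b.c., with `a^{d−4}/g² = β/2` and `Λ_r = #E_n^1`:
`f_n(β) = Λ_r^{−1} log Z(B_n, β) + (N²/2) log(β/2)`. [cite: FariaDaVeigaOCarroll2022YMStability, (nZ)–(nf) (chunk p0015)] -/
def fn (n : ℕ) (β : ℝ) : ℝ :=
  (#(freeEdges d n) : ℝ)⁻¹ * Real.log (Z d N n β).toReal + ((N * N : ℕ) : ℝ) / 2 * Real.log (β / 2)

/-- `log((√β)^{m}) = (m/2) log β`. [folklore] -/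
private theorem log_sqrt_pow {β : ℝ} (hβ : 0 < β) (m : ℕ) :
    Real.log (Real.sqrt β ^ m) = (m : ℝ) / 2 * Real.log β := by
  rw [Real.log_pow, Real.log_sqrt hβ.le]; ring

/-- **THEOREM 3 (free b.c.), the two-sided bound (bdsf)**: for every `β₀ > 0` there are finite real constants `c_ℓ, c_u`,
independent of the volume and of the coupling, with `c_ℓ ≤ f_n(β) ≤ c_u` for EVERY cube side `n` with `Λ_r ≥ 1` and EVERY
`β ≥ β₀` — the print's «`−∞ < c_ℓ ≤ f^{B,n}_a ≤ c_u < ∞` … The constants `c_ℓ` and `c_u` are finite real constants independent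
of `a ∈ (0,1]` and `g² ∈ (0, g₀²]`, `0 < g₀ < ∞`» (`β = 2a^{d−4}/g² ≥ β₀ := 2/g₀²` for `d ≤ 4`), here at the FINITE-LATTICE
level — the print's §6.4 chain «`f^{n}_{Λ,a} = Λ_r^{−1} ln[(a^{d−4}/g²)]^{N²Λ_r/2} + Λ_r^{−1} ln Z_{Λ,a} ≥ … + Λ_r^{−1} ln
z_ℓ^{Λ_r} ≥ …`» — from which the printed (subsequential) thermodynamic and continuum limits inherit the bound by
Bolzano–Weierstrass; soft constants (from the soft Theorem 2 above).
[cite: FariaDaVeigaOCarroll2022YMStability, Theorem 3 (bdsf) (chunk p0015); proof §6.4 (p0018)] -/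
theorem theorem3_free_bounds {β₀ : ℝ} (hβ₀ : 0 < β₀) : ∃ cl cu : ℝ, ∀ (n : ℕ), 1 ≤ #(freeEdges d n) →
    ∀ β : ℝ, β₀ ≤ β → cl ≤ fn d N n β ∧ fn d N n β ≤ cu := by
  obtain ⟨Cl, hCl, hzl⟩ := exists_zl_ge (d := d) (N := N) hβ₀
  obtain ⟨Cu, hCu, hzu⟩ := exists_zu_le (N := N)
  refine ⟨Real.log Cl - ((N * N : ℕ) : ℝ) / 2 * Real.log 2, Real.log Cu - ((N * N : ℕ) : ℝ) / 2 * Real.log 2,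
    fun n hn β hβ => ?_⟩
  have hβ0 : 0 < β := hβ₀.trans_le hβ
  have hsβ : 0 < Real.sqrt β ^ (N * N) := pow_pos (Real.sqrt_pos.2 hβ0) _
  have hΛ : (0 : ℝ) < #(freeEdges d n) := by exact_mod_cast hn
  obtain ⟨hlow, hup⟩ := theorem1_free (d := d) (N := N) hβ0.le n
  have hx : 0 < Cl / Real.sqrt β ^ (N * N) := div_pos hCl hsβ
  have hy : 0 < Cu / Real.sqrt β ^ (N * N) := div_pos hCu hsβ
  have hZlow : (Cl / Real.sqrt β ^ (N * N)) ^ #(freeEdges d n) ≤ (Z d N n β).toReal := by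
    rw [← ENNReal.ofReal_le_iff_le_toReal (ne_top_of_le_ne_top ENNReal.one_ne_top (Z_le_one n hβ0.le)),
      ENNReal.ofReal_pow hx.le]
    exact (pow_le_pow_left' (hzl β hβ) _).trans hlow
  have hZup : (Z d N n β).toReal ≤ (Cu / Real.sqrt β ^ (N * N)) ^ #(freeEdges d n) := by
    refine ENNReal.toReal_le_of_le_ofReal (pow_nonneg hy.le _) ?_
    rw [ENNReal.ofReal_pow hy.le]
    exact hup.trans (pow_le_pow_left' (hzu β hβ0) _)
  have hZpos : 0 < (Z d N n β).toReal := lt_of_lt_of_le (pow_pos hx _) hZlow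
  have hlog1 : (#(freeEdges d n) : ℝ) * (Real.log Cl - ((N * N : ℕ) : ℝ) / 2 * Real.log β) ≤
      Real.log (Z d N n β).toReal := by
    have := Real.log_le_log (pow_pos hx _) hZlow
    rwa [Real.log_pow, Real.log_div hCl.ne' hsβ.ne', log_sqrt_pow hβ0] at this
  have hlog2 : Real.log (Z d N n β).toReal ≤
      (#(freeEdges d n) : ℝ) * (Real.log Cu - ((N * N : ℕ) : ℝ) / 2 * Real.log β) := by
    have := Real.log_le_log hZpos hZup
    rwa [Real.log_pow, Real.log_div hCu.ne' hsβ.ne', log_sqrt_pow hβ0] at this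
  have hlogβ2 : Real.log (β / 2) = Real.log β - Real.log 2 := Real.log_div hβ0.ne' two_ne_zero
  unfold fn
  rw [hlogβ2]
  constructor
  · have h : Real.log Cl - ((N * N : ℕ) : ℝ) / 2 * Real.log β ≤
        (#(freeEdges d n) : ℝ)⁻¹ * Real.log (Z d N n β).toReal := by
      rw [le_inv_mul_iff₀ hΛ]; exact hlog1
    linarith
  · have h : (#(freeEdges d n) : ℝ)⁻¹ * Real.log (Z d N n β).toReal ≤
        Real.log Cu - ((N * N : ℕ) : ℝ) / 2 * Real.log β := by
      rw [inv_mul_le_iff₀ hΛ]; exact hlog2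
    linarith

end SingleBond

/-! ### Periodic b.c.: the normalized free energy of the torus and its bounds in the thermodynamic limit -/

section PeriodicFreeEnergy

variable {L : ℕ} [NeZero L]

variable (d N) in
/-- The finite-torus **normalized free energy**, periodic b.c.: (nZ)–(nf) with `Z^P` in place of `Z` and the same
normalization `Λ_r` («`f^{P,n}_{Λ,a} = Λ_r^{−1} ln Z^{P,n}_{Λ,a}`», §6.4): `f^P_L(β) = Λ_r^{−1} log Z^P + (N²/2) log(β/2)`.
[cite: FariaDaVeigaOCarroll2022YMStability, (nZ)–(nf) (chunk p0015), §6.4 (p0018)] -/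
def fnP (L : ℕ) [NeZero L] (β : ℝ) : ℝ :=
  (#(freeEdges d L) : ℝ)⁻¹ * Real.log (ZP d N L β).toReal + ((N * N : ℕ) : ℝ) / 2 * Real.log (β / 2)

/-- `Z^P < ∞` (`Z^P ≤ Z ≤ 1`). [cite: FariaDaVeigaOCarroll2022YMStability, Theorem 1 (sbperiodic)] -/
theorem ZP_ne_top {β : ℝ} (hβ : 0 ≤ β) (L : ℕ) [NeZero L] : ZP d N L β ≠ ∞ :=
  ne_top_of_le_ne_top (ne_top_of_le_ne_top ENNReal.one_ne_top (Z_le_one L hβ)) (ZP_le_Z hβ)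

/-- `Z^P > 0` (`Z^P ≥ z_ℓ^{dL^d} > 0`). [cite: FariaDaVeigaOCarroll2022YMStability, Theorem 1 (sbperiodic)] -/
theorem ZP_toReal_pos {β : ℝ} (hβ : 0 < β) (L : ℕ) [NeZero L] : 0 < (ZP d N L β).toReal := by
  obtain ⟨C, hC, h⟩ := exists_zl_ge (d := d) (N := N) hβ
  have hs : 0 < Real.sqrt β ^ (N * N) := pow_pos (Real.sqrt_pos.2 hβ) _
  have hzl : 0 < zl d N β := lt_of_lt_of_le (ENNReal.ofReal_pos.2 (div_pos hC hs)) (h β le_rfl)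
  have hpos : 0 < ZP d N L β := lt_of_lt_of_le (ENNReal.pow_pos hzl _) (zl_pow_card_le_ZP hβ.le)
  exact ENNReal.toReal_pos hpos.ne' (ZP_ne_top hβ.le L)

/-- `f^P_L ≤ f_L` (from `Z^P ≤ Z`). [cite: FariaDaVeigaOCarroll2022YMStability, §6.4 (p0018)] -/
theorem fnP_le_fn {β : ℝ} (hβ : 0 < β) (L : ℕ) [NeZero L] : fnP d N L β ≤ fn d N L β := by
  unfold fnP fn
  have hmono : (ZP d N L β).toReal ≤ (Z d N L β).toReal :=
    ENNReal.toReal_mono (ne_top_of_le_ne_top ENNReal.one_ne_top (Z_le_one L hβ.le)) (ZP_le_Z hβ.le)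
  have hlog := Real.log_le_log (ZP_toReal_pos hβ L) hmono
  have hinv : 0 ≤ (#(freeEdges d L) : ℝ)⁻¹ := inv_nonneg.2 (Nat.cast_nonneg _)
  nlinarith [mul_le_mul_of_nonneg_left hlog hinv]

omit [NeZero L] in
/-- For `d ≥ 2` and `L ≥ 4`: `Λ_r ≥ (d−1)L^d/2`. [folklore] -/
private theorem card_freeEdges_ge (hd : 2 ≤ d) (hL : 4 ≤ L) :
    ((d : ℝ) - 1) * (L : ℝ) ^ d / 2 ≤ (#(freeEdges d L) : ℝ) := by
  have hd1 : 1 ≤ d := by omega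
  have hL1 : 1 ≤ L := by omega
  rw [card_freeEdges (d := d) hd1 hL1]
  have hLd : (L : ℝ) ^ d = L * (L : ℝ) ^ (d - 1) := by
    rw [← pow_succ']; congr 1; omega
  have hP : (0 : ℝ) < (L : ℝ) ^ (d - 1) := pow_pos (by exact_mod_cast (show 0 < L by omega)) _
  have h4 : (4 : ℝ) ≤ L := by exact_mod_cast hL
  have h2 : (2 : ℝ) ≤ d := by exact_mod_cast hd
  rw [hLd]
  nlinarith [mul_le_mul_of_nonneg_right (show (2 : ℝ) * d ≤ (d - 1) * L by nlinarith) hP.le]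

/-- **THEOREM 3, periodic b.c.**: with the SAME constants `c_ℓ, c_u` as for free b.c. (uniform in the volume and in `β ≥ β₀`),
the finite-torus normalized free energy satisfies `f^P_L(β) ≤ c_u` for every `L` (with `Λ_r ≥ 1`), and `f^P_L(β) ≥ c_ℓ − ε` for
all `L ≥ L₀(β, ε)` — so every (subsequential) thermodynamic limit `f^{P,n}_a` obeys (bdsf) `c_ℓ ≤ f^{P,n}_a ≤ c_u`, as printed.
The print's §6.4: «`f^{P,n}_{Λ,a} ≥ ln[(a^{d−4}/g²)]^{N²/2} + ((Λ_e+Λ_r)/Λ_r)[ln(a^{d−4}/g²)^{−N²/2} + c_ℓ]` … which gives, when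
`Λ → aℤ^d`, `f^{P,n}_a ≥ c_ℓ`»: at finite volume the factor `(Λ_e+Λ_r)/Λ_r = 1 + dL^{d−1}/Λ_r` is not uniform in `β`, exactly as
here (`Λ_e/Λ_r ≤ 4/L` for `L ≥ 4`, `d ≥ 2`).
[cite: FariaDaVeigaOCarroll2022YMStability, Theorem 3 (bdsf) periodic b.c. (chunk p0015); proof §6.4 (p0018)] -/
theorem theorem3_periodic (hd : 2 ≤ d) {β₀ : ℝ} (hβ₀ : 0 < β₀) : ∃ cl cu : ℝ,
    (∀ (n : ℕ), 1 ≤ #(freeEdges d n) → ∀ β : ℝ, β₀ ≤ β → cl ≤ fn d N n β ∧ fn d N n β ≤ cu) ∧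
    (∀ (L : ℕ) [NeZero L], 1 ≤ #(freeEdges d L) → ∀ β : ℝ, β₀ ≤ β → fnP d N L β ≤ cu) ∧
    (∀ β : ℝ, β₀ ≤ β → ∀ ε : ℝ, 0 < ε → ∃ L₀ : ℕ, ∀ (L : ℕ) [NeZero L], L₀ ≤ L → cl - ε ≤ fnP d N L β) := by
  obtain ⟨Cl, hCl, hzl⟩ := exists_zl_ge (d := d) (N := N) hβ₀
  obtain ⟨cl', cu, hfree⟩ := theorem3_free_bounds (d := d) (N := N) hβ₀
  -- the free lower constant of `theorem3_free_bounds` is `log Cl − (N²/2) log 2` for ITS `Cl`; we re-derive the free lower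
  -- bound for the present `Cl` so that the same `c_ℓ` serves both boundary conditions
  set cl : ℝ := Real.log Cl - ((N * N : ℕ) : ℝ) / 2 * Real.log 2 with hcl
  have hlogβ2 : ∀ {β : ℝ}, 0 < β → Real.log (β / 2) = Real.log β - Real.log 2 :=
    fun hβ0 => Real.log_div hβ0.ne' two_ne_zero
  -- `A(β) = log(Cl (√β)^{−N²}) ≤ 0` and `log z_ℓ ≥ A(β)`
  have hA : ∀ {β : ℝ}, β₀ ≤ β → Real.log (Cl / Real.sqrt β ^ (N * N)) ≤ Real.log (zl d N β).toReal ∧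
      Real.log (zl d N β).toReal ≤ 0 ∧ 0 < (zl d N β).toReal ∧
      Real.log (Cl / Real.sqrt β ^ (N * N)) = Real.log Cl - ((N * N : ℕ) : ℝ) / 2 * Real.log β := by
    intro β hβ
    have hβ0 : 0 < β := hβ₀.trans_le hβ
    have hs : 0 < Real.sqrt β ^ (N * N) := pow_pos (Real.sqrt_pos.2 hβ0) _
    have hx : 0 < Cl / Real.sqrt β ^ (N * N) := div_pos hCl hs
    have hne : zl d N β ≠ ∞ := ne_top_of_le_ne_top ENNReal.one_ne_top (zl_le_one hβ0.le)
    have hxle : Cl / Real.sqrt β ^ (N * N) ≤ (zl d N β).toReal := (ENNReal.ofReal_le_iff_le_toReal hne).1 (hzl β hβ)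
    have hzl1 : (zl d N β).toReal ≤ 1 :=
      ENNReal.toReal_le_of_le_ofReal zero_le_one (by simpa using zl_le_one (d := d) (N := N) hβ0.le)
    have hpos : 0 < (zl d N β).toReal := hx.trans_le hxle
    exact ⟨Real.log_le_log hx hxle, Real.log_nonpos hpos.le hzl1, hpos,
      by rw [Real.log_div hCl.ne' hs.ne', log_sqrt_pow hβ0]⟩
  refine ⟨cl, cu, fun n hn β hβ => ⟨?_, (hfree n hn β hβ).2⟩, fun L _ hΛ β hβ => ?_, fun β hβ ε hε => ?_⟩
  · -- free lower bound with this `Cl` (as in `theorem3_free_bounds`)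
    have hβ0 : 0 < β := hβ₀.trans_le hβ
    obtain ⟨hlogzl, -, hzpos, hAeq⟩ := hA hβ
    have hΛ : (0 : ℝ) < #(freeEdges d n) := by exact_mod_cast hn
    have hZne : Z d N n β ≠ ∞ := ne_top_of_le_ne_top ENNReal.one_ne_top (Z_le_one n hβ0.le)
    have hZlow : (zl d N β).toReal ^ #(freeEdges d n) ≤ (Z d N n β).toReal := by
      rw [← ENNReal.toReal_pow]
      exact ENNReal.toReal_mono hZne (zl_pow_le_Z hβ0.le n)
    have hZpos : 0 < (Z d N n β).toReal := lt_of_lt_of_le (pow_pos hzpos _) hZlow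
    have h1 : (#(freeEdges d n) : ℝ) * Real.log (zl d N β).toReal ≤ Real.log (Z d N n β).toReal := by
      have := Real.log_le_log (pow_pos hzpos _) hZlow
      rwa [Real.log_pow] at this
    have h2 : Real.log (zl d N β).toReal ≤ (#(freeEdges d n) : ℝ)⁻¹ * Real.log (Z d N n β).toReal := by
      rw [le_inv_mul_iff₀ hΛ]; exact h1
    unfold fn
    rw [hlogβ2 hβ0, hcl]
    linarith
  · exact (fnP_le_fn (hβ₀.trans_le hβ) L).trans (hfree L hΛ β hβ).2
  · -- periodic lower bound, eventually in `L`
    have hβ0 : 0 < β := hβ₀.trans_le hβ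
    obtain ⟨hlogzl, hlog0, hzpos, hAeq⟩ := hA hβ
    set A : ℝ := Real.log (Cl / Real.sqrt β ^ (N * N)) with hAdef
    have hA0 : A ≤ 0 := hlogzl.trans hlog0
    obtain ⟨L₁, hL₁⟩ := exists_nat_ge (4 * |A| / ε)
    refine ⟨max 4 L₁, fun L _ hL => ?_⟩
    have hL4 : 4 ≤ L := le_of_max_le_left hL
    have hLL₁ : (L₁ : ℝ) ≤ L := by exact_mod_cast le_of_max_le_right hL
    have hd1 : 1 ≤ d := by omega
    have hL1 : 1 ≤ L := by omega
    have hLpos : (0 : ℝ) < L := by exact_mod_cast (show 0 < L by omega)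
    have hP : (0 : ℝ) < (L : ℝ) ^ (d - 1) := pow_pos hLpos _
    have hLd : (L : ℝ) ^ d = L * (L : ℝ) ^ (d - 1) := by
      rw [← pow_succ']; congr 1; omega
    have hΛge := card_freeEdges_ge (d := d) hd hL4
    have hd2 : (2 : ℝ) ≤ d := by exact_mod_cast hd
    have hΛpos : (0 : ℝ) < #(freeEdges d L) := by
      have : (0 : ℝ) < ((d : ℝ) - 1) * (L : ℝ) ^ d / 2 := by
        have : (0 : ℝ) < (L : ℝ) ^ d := pow_pos hLpos _
        nlinarith
      linarith
    -- the exponent `K = Λ_r + Λ_e`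
    have hK : ((d * L ^ d - (L ^ d - 1) : ℕ) : ℝ) = (#(freeEdges d L) : ℝ) + d * (L : ℝ) ^ (d - 1) := by
      rw [← card_freeEdges_add_closing (d := d) hd1 hL1]; push_cast; ring
    -- `Λ_e/Λ_r ≤ 4/L`
    have hratio : (d : ℝ) * (L : ℝ) ^ (d - 1) / #(freeEdges d L) ≤ 4 / L := by
      rw [div_le_div_iff₀ hΛpos hLpos]
      -- `d L^{d-1} L ≤ 4 Λ_r`, from `4 Λ_r ≥ 2(d−1)L^d ≥ d L^d`
      have h1 : (d : ℝ) * (L : ℝ) ^ d ≤ 2 * (((d : ℝ) - 1) * (L : ℝ) ^ d) := by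
        have : (0 : ℝ) < (L : ℝ) ^ d := pow_pos hLpos _
        nlinarith
      rw [hLd] at h1
      nlinarith [hΛge, hLd]
    -- `Z^P ≥ z_ℓ^K`
    have hZPne : ZP d N L β ≠ ∞ := ZP_ne_top hβ0.le L
    have hZPlow : (zl d N β).toReal ^ (d * L ^ d - (L ^ d - 1)) ≤ (ZP d N L β).toReal := by
      rw [← ENNReal.toReal_pow]
      exact ENNReal.toReal_mono hZPne (zl_pow_le_ZP hβ0.le)
    have h1 : ((d * L ^ d - (L ^ d - 1) : ℕ) : ℝ) * Real.log (zl d N β).toReal ≤ Real.log (ZP d N L β).toReal := by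
      have := Real.log_le_log (pow_pos hzpos _) hZPlow
      rwa [Real.log_pow] at this
    -- `K · log z_ℓ ≥ K · A`
    have h2 : ((d * L ^ d - (L ^ d - 1) : ℕ) : ℝ) * A ≤ ((d * L ^ d - (L ^ d - 1) : ℕ) : ℝ) * Real.log (zl d N β).toReal :=
      mul_le_mul_of_nonneg_left hlogzl (Nat.cast_nonneg _)
    -- divide by `Λ_r`: `Λ_r⁻¹ log Z^P ≥ (1 + Λ_e/Λ_r) A ≥ A − (4/L)|A| ≥ A − ε`
    have h3 : ((#(freeEdges d L) : ℝ) + d * (L : ℝ) ^ (d - 1)) * A ≤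
        (#(freeEdges d L) : ℝ) * ((#(freeEdges d L) : ℝ)⁻¹ * Real.log (ZP d N L β).toReal) := by
      rw [mul_inv_cancel_left₀ hΛpos.ne', ← hK]; exact h2.trans h1
    have h4 : A + (d : ℝ) * (L : ℝ) ^ (d - 1) / #(freeEdges d L) * A ≤
        (#(freeEdges d L) : ℝ)⁻¹ * Real.log (ZP d N L β).toReal := by
      have := div_le_div_of_nonneg_right h3 hΛpos.le
      rwa [mul_div_cancel_left₀ _ hΛpos.ne', add_mul, add_div, mul_div_cancel_left₀ _ hΛpos.ne',
        mul_comm ((d : ℝ) * _) A, mul_div_assoc, mul_comm A] at this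
    have h5 : -ε ≤ (d : ℝ) * (L : ℝ) ^ (d - 1) / #(freeEdges d L) * A := by
      -- `ratio · A ≥ −(4/L)|A| ≥ −ε`
      have hr0 : 0 ≤ (d : ℝ) * (L : ℝ) ^ (d - 1) / #(freeEdges d L) := by positivity
      have hεL : 4 * |A| / L ≤ ε := by
        rcases eq_or_lt_of_le (abs_nonneg A) with h0 | hpos
        · rw [← h0]; simp; exact hε.le
        · rw [div_le_iff₀ hLpos]
          have h1 := (div_le_iff₀ hε).1 hL₁
          nlinarith [mul_le_mul_of_nonneg_right hLL₁ hε.le, hpos]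
      have hAabs : A = -|A| := by rw [abs_of_nonpos hA0]; ring
      rw [hAabs, mul_neg]
      have : (d : ℝ) * (L : ℝ) ^ (d - 1) / #(freeEdges d L) * |A| ≤ 4 / L * |A| :=
        mul_le_mul_of_nonneg_right hratio (abs_nonneg A)
      have : 4 / (L : ℝ) * |A| = 4 * |A| / L := by ring
      linarith
    unfold fnP
    rw [hlogβ2 hβ0, hcl]
    have hAeq' : A = Real.log Cl - ((N * N : ℕ) : ℝ) / 2 * Real.log β := hAeq
    linarith

end PeriodicFreeEnergy

end FariaDaVeigaOCarroll2022

end Literature.MathematicalPhysics.QuantumFieldTheory
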